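import Literature.MathematicalPhysics.QuantumFieldTheory.BalabanImbrieJaffe1984to88.BIJ85Ineq732FlatRegion
import Literature.MathematicalPhysics.QuantumFieldTheory.BalabanImbrieJaffe1984to88.BIJ85Ineq732General
import Literature.MathematicalPhysics.QuantumFieldTheory.Balaban1983to89.B1RG242Torus

/-!
# `BalabanImbrieJaffe1984to88.BIJ85Ineq732SmallFieldRegion` — T. Bałaban, J. Imbrie, A. Jaffe, *Renormalization of the Higgs model: minimizers,
propagators and the stability of mean field theory*, Commun. Math. Phys. **97** (1985) 299–329 [BalabanImbrieJaffe1985]: Sect. 7.3 p. 326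
**THE SCALAR STABILITY ESTIMATE (7.3.2) FOR THE REGION FORM `Δ_k(Ω,u)` ON EVERY UNION `Ω` OF `k`-BLOCKS OF THE TORUS, AT A GENERAL `U(1)`
BACKGROUND WITH SMALL PLAQUETTES** (Neumann boundary conditions on `Ω`, [BalabanImbrieJaffe1988] p. 262; [7] = [Balaban1983RegularityDecay]
«Prop. 3.1′» (1.22): *"Let Ω be a sum of unit blocks"*) — for gen 15's torus objects WITH BODIES (`BIJ88DeltaLoc234Torus.deltaRegion` over the
constructed Neumann propagator `BIJ88NeumannPropagator227Torus.gBox`), every torus, every level `k`, constants `γ = min(a/(8(d+1)), Nc²/(12n²))`,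
error `(4/3)d⁴(Nc²/n²)(n²θ)²` depending on `(a, d)` and the plaquette size `θ` only (at the physical normalization `c² = n²/N`:
`γ = min(a/(9(d+1)), 1/12)`, error `(4/3)d⁴(L^{2k}θ)²`).  p11 gen 5's `BIJ85Ineq732General.ineq732_general` (the general-background member of record of
row C1.Eq7.3.1-7.3.2) is the case `Ω = T` in the real-linear-map framework; gen 18's `BIJ85Ineq732FlatRegion` is the case `θ = 0` for regions; this
file is the REGION version AT NON-FLAT `u` — the (I.7.3.2)-input of the non-flat (2.38) of [BalabanImbrieJaffe1988] for `Δ_{k,loc}(u)` *"in view of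
(2.35)"* on the `k`-block cubes `□_α^{(k)}` (companion-to-be of this seat's `BIJ88Ineq238FlatTorus`, flat case).

statement-level skeleton of published theorems with citation tags; proofs where landed; nothing here is a claim about the Yang–Mills mass gap

PDF held: `paper:balaban1985-cmp97-bij-higgs-minimizers` (journal page = PDF page + 298); p. 313 [PDF 15] (4.6.1)–(4.6.4) and p. 326 [PDF 28]
(7.3.1)–(7.3.2) as transcribed verbatim in p11's `BIJ85Ineq732General` / `BIJ85Ineq732Flat` (quoted below); [BalabanImbrieJaffe1988]
(CMP **114**, `paper:balaban1988-cmp114-bij-abelian-higgs-effective-action`, journal page = PDF page + 256) p. 262–264 [PDF 6–8] (renders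
`HOME/lit-balaban-p31/renders/original-p007-x2.png`, `original-p008-x2.png`); [7] = [Balaban1983RegularityDecay] (CMP **89**) p. 574 (1.21)–(1.22) as
transcribed in the tree's `Balaban1983to89.B4Prop31Zero`.

CITATION HEADER (lean-in-tree rule).  Part of the lit-balaban TYPED SKELETON (HOME `run/shared/lean/pub/lit-balaban/`), PHASE-2 proof seat
p31 gen 20 (unit `lit-balaban-p31`, literature-prover-lit-balaban-p31-g20-0; TAKING line HOME/STATUS.md 2026-08-22T23:5xZ; free-target protocol
G.5-34(d) — item 2 (ii) of the owner's `HOME/lit-balaban-r18/C2S14-CLOSURE.md` §5 v1.16b: *"(2.38) (needs the non-flat Poincaré-type lower bound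
(I.7.3.2) for Δ_k(Ω,u), p31's `BIJ85Ineq732…` files are flat/region-level)"*).  WHAT IS REPRODUCED: row **C1.Eq7.3.1-7.3.2** (`HOME/lit-balaban-r15/ROWS-C1.md`,
owner r15; general-background member of record p11's `BIJ85Ineq732General.ineq732_general`, `Ω = T`) as a located member FOR REGIONS `Ω ⊂ T^{(j)}` AT A
GENERAL SMALL-PLAQUETTE BACKGROUND and for gen 15's explicit `deltaRegion`; rows **C2.Eq2.35** / **C2.Eq2.38** (owner r18) cells: the positivity / lower
bound of the comparison object `Δ_k(Ω,u)` at non-flat `u`.  Kind «model-level theorems only» (no definition, no `Prop`-valued fact).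

THE PRINTED TEXT (verbatim).  p. 326 [PDF 28]: *"7.3. Positivity of Δ_k(u_k).  The scalar field quadratic form Δ_k(u_k) depends on the
background field u_k. Hence we can only establish stability properties for Δ_k(u_k) with some restriction on u_k. In particular, let us
assume that for the unit lattice field v, |v(∂p) − 1| ≤ e_k𝓅(e_k), (7.3.1) where 𝓅(e_k) = (1 + ln e_k^{−1})^𝓅. Then the stability estimate can
be stated in two forms. For constants γ > 0, α > 0, M < ∞, ⟨φ, Δ_k(u_k)φ⟩ ≥ γ Σ_{b∈T₁^{(k)}} |u_k(b)φ(b₊) − φ(b₋)|² − Me_k^{2−α} Σ_{x∈T₁^{(k)}}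
|φ(x)|². (7.3.2) The second form of the inequality substitutes v_b for u_k(b) in the covariant derivative of φ. These inequalities can be proved
by an extension of the proofs of [7]."*  [7] p. 574: *"Proposition 3.1′ of [2]. Let Ω be a sum of unit blocks (i.e. Ω^{(k)} is an arbitrary
subset of Z^d) and let A satisfies the condition |(∂^η_μA)(x)| ≤ O(1)p(e) … then there exists a positive constant γ₀ depending on d only, such
that for e sufficiently small ⟨φ, Δ^{(k)}(Ω,A)φ⟩ ≥ γ₀(Σ_{⟨x,x′⟩⊂Ω^{(k)}} |U(A(⟨x,x′⟩))φ(x′) − φ(x)|² + m²Σ_{x∈Ω^{(k)}}|φ(x)|²) − O(1)e^{2−α}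
Σ_{x∈Ω^{(k)}}|φ(x)|² (1.22)"*.  [BalabanImbrieJaffe1988] p. 262 [PDF 6]: *"In the scalar field sector, we have the η-lattice propagators G_k(Ω,u)
defined on subsets Ω ⊂ T_η with Neumann boundary conditions."*; p. 264 [PDF 8]: *"Finally, in view of (2.35), the lower bound (I.7.3.2) applies to
Δ_{k,loc}(u) as well. Let φ be supported in a region having an r(e_k) neighborhood where u is smooth. Then ⟨φ, Δ_{k,loc}(u)φ⟩ ≥ c₁Σ_b|u(b)φ(b₊) −
φ(b₋)|² − ce_k²p(e_k)²Σ_x|φ(x)|². (2.38)"*.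

THE OBJECTS (gen 15's definitions, unchanged).  `Δ_k(Ω,u) = BIJ88DeltaLoc234Torus.deltaRegion a c U k Ω = a·1 − a²·Q_k(u)G_k(Ω,u)Q_k(u)ᴴ` on
`ℓ²(T^{(j+k)})`, `G_k(Ω,u) = BIJ88NeumannPropagator227Torus.gBox a c U k Ω`, `Ω ⊂ T^{(j)}` a union of `k`-blocks (`IsBlockUnion k Ω`),
`Ω^{(k)} = innerK k Ω` = the unit-lattice sites `y` with `B^k(y) ⊆ Ω`, `Ω^{(k)*} = starB (innerK k Ω)` = the unit bonds with both ends in `Ω^{(k)}`,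
`Ω* = starB Ω` = the fine bonds with both ends in `Ω`; `u_k(b) = lineIter u k b` (the transport of `u` along the straight unit bond, [I] (5.1.2),
p11); the plaquette variables `plaqC u x μ ν` (p11 gen 5 `BIJ85AbelianStokes`); `n = L^k`, `N = L^{kd}`.

THE MECHANISM — p11 gen 5's whole-torus argument (`BIJ85CovariantPoincare` + `BIJ85Ineq732General`) LOCALIZED TO A `k`-BLOCK UNION; the point
is that every step is a sum of PER-BLOCK / PER-COARSE-BOND estimates whose fine-lattice data stay inside `Ω`.  (§0) Region bookkeeping without
level casts: `Ω^{(i+1)} = (Ω^{(i)})^{(1)}` (`innerK_succ_eq`, both sides in `T^{(j+i+1)}`), a `k`-block union is an `i`-block union for `i ≤ k`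
(`isBlockUnion_of_le`), and then `Ω^{(i)}` is a union of blocks of `T^{(j+i)}` (`isBlockUnion_one_innerK`: a point of `B^i(y) ⊆ Ω` has its
`(i+1)`-block in `Ω`); `Σ_{x∈Ω} = Σ_{y∈Ω^{(k)}}Σ_{x∈B^k(y)}` (`sum_region_eq_sum_innerK`).  (§1) p11 gen 4's covariant block-averaging inequality with
holonomy defect, ONE COARSE BOND AT A TIME (`norm_qCovK_shift_sub_sq_le_cov` — the `have hB` inside p11's
`BIJ85BlockAveragingIneqCov.sum_norm_qCovK_shift_sub_sq_le_cov`, exported): Jensen over `B^k(y)`, the pairing `x ↔ x + ne_μ`, covariant telescoping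
along the straight run (`norm_runProd_mul_sub_sq_le` BY NAME), the defect `ρ_μ(x) = u(Γ^{(k)}_x)^{−1}Wu(Γ^{(k)}_{x+ne_μ})u(run)^{−1}` of the loop (2.10).
(§2) Its REGION SUM (`sum_norm_qCovK_shift_sub_sq_region_le_cov`): the runs from `B^k(y)` with `B^k(y), B^k(y+e_μ) ⊆ Ω` stay in `Ω*` (gen 18's
`runBond_mem_starB`), each fine bond of `Ω` serves at most `n` (point, step) pairs, `x + ne_μ ∈ Ω` is met once per direction:
`E_{W,Ω^{(k)*}}(Q_k(u)φ) ≤ 2(n²/N)Σ_{b∈Ω*}|u_bφ(b₊) − φ(b₋)|² + 2N^{−1}ρ̄²dΣ_{x∈Ω}|φ(x)|²` for any uniform defect bound `|ρ_μ(x) − 1| ≤ ρ̄`.  (§3) Jensen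
on a region (`sum_norm_qCovK_sq_region_le`), the tail count `Σ_{b∈X*}f(b₊) ≤ dΣ_{x∈X}f` (`sum_starB_tgt_le`), and p11's per-block `covPoincare_block`
summed over the blocks inside a block union `X ⊂ T^{(i)}` (`covPoincare_region`).  (§4) **THE MULTISCALE MASS BOUND ON A REGION**
(`massBound_region`): p11's telescoping over the levels `i < k` — at level `i` the region `Ω^{(i)}` (a block union of `T^{(j+i)}` by §0), the
field `u^{(i)} = lineIter u i` with plaquettes `≤ L^{2i}θ` (`norm_plaqC_lineIter_sub_one_le`), the block-contour defect `≤ dL^i(L^i − 1)L^{2i}…`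
(`norm_blockContourDefect_sub_one_le′` BY NAME), §2 at level `i`, §3, and p11's real-variable step `massBound_step_real` BY NAME:
`N^{−1}Σ_{x∈Ω}|φ|² ≤ Σ_{y∈Ω^{(k)}}|(Q_k(u)φ)(y)|² + 2(n²/N)Σ_{b∈Ω*}|u_bφ(b₊) − φ(b₋)|² + d³(n²θ)²N^{−1}Σ_{x∈Ω}|φ|²` (why multiscale: a single-scale
`k`-block Poincaré inequality pays the composite-contour holonomy of an in-block bond, up to `∼ dL^{2k−1}` plaquettes, against the Poincaré
constant `n²` — not `k`-uniform; level by level each step pays `L²×(dL·L^{2i}θ)²` and the bookkeeping is geometric).  (§5) THE ASSEMBLY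
(`ineq732_smallField_region`): gen 18's ENERGY IDENTITY `ψᴴΔ_k(Ω,u)ψ = a‖Q_kφ⋆ − ψ‖² + Σ_{b∈Ω*}‖D_uφ⋆(b)‖²` at `φ⋆ = aG_k(Ω,u)Q_k(u)ᴴψ`
(`form_deltaRegion_eq_energy`, EVERY `u`); `E(ψ) ≤ 2E(ψ − Q_kφ⋆) + 2E(Q_kφ⋆) ≤ 8d‖ψ − Q_kφ⋆‖²_{Ω^{(k)}} + 2E(Q_kφ⋆)`; §2 with `W = u_k`,
`ρ̄ = dn²θ`; §4 for `φ⋆`; `‖Q_kφ⋆‖²_{Ω^{(k)}} ≤ 2‖Q_kφ⋆ − ψ‖² + 2‖ψ‖²_{Ω^{(k)}}`; p11's private real-variable `assembly_real` (restated verbatim, two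
regimes `d³s² ≤ ½` / `> ½`).  (§6) `Ω = T` recovers p11's statement for gen 15's object (`ineq732_smallField_univ`); the region propagator and
form scale as `G_{(s²a,sc)} = s^{−2}G_{(a,c)}`, `Δ_{(s²a,sc)} = s²Δ_{(a,c)}` (`gBox_smul`, `deltaRegion_smul` via gen 15's `eq_gBox_of_left_inverse`;
gen 19's `…_univ_smul` are `Ω = T`), whence the statement for the object of record `deltaRegion (α_kL^{kd}) ε^{−1} u k Ω` with the factor `A/a_k`
(`ineq238_deltaRegion_smallField_region`, the region analogue of gen 19's `ineq238_deltaRegion_bg454`).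

WHAT IS PROVED (theorems only; 0 `sorry`; standard axioms; no new definition, no `Prop`-valued fact).
* §0 `mem_innerK_succ_iff`, `isBlockUnion_of_le`, **`isBlockUnion_one_innerK`**, `sum_region_eq_sum_innerK`, `blockK_one`,
  `sum_region_eq_sum_innerK_one`, `sum_innerK_blockK_le`.
* §1 **`norm_qCovK_shift_sub_sq_le_cov`** (one coarse bond; every `u`, `W`, `φ`).
* §2 **`sum_norm_qCovK_shift_sub_sq_region_le_cov`** (every `Ω`, every `u`, `W`, `φ`, any defect bound `ρ̄`).
* §3 `innerK_succ_eq`, `innerK_zero_eq`, `sum_norm_qCovK_sq_region_le`, `sum_starB_tgt_le`, **`covPoincare_region`**.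
* §4 **`massBound_region`**, `massBound_region_small` (`2d³(n²θ)² ≤ 1 ⟹ N^{−1}Σ_{Ω}|φ|² ≤ 2Σ_{Ω^{(k)}}|Q_kφ|² + 4(n²/N)Σ_{Ω*}|D_uφ|²/c²`).
* §5 `sum_norm_cov_sub_sq_le_four_d`, `norm_covD_sq`, (private) `sq_le_two_sq_add`, `assembly_real`; **`ineq732_smallField_region`**: for `j + k ≤ m + K`,
  `a > 0`, `c ≠ 0`, EVERY `U(1)` field `u` with `|u(∂p) − 1| ≤ θ` at every plaquette, EVERY `k`-block union `Ω`, EVERY `ψ`: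
  `min(a/(8(d+1)), Nc²/(12n²))·Σ_{b∈Ω^{(k)*}}|u_k(b)ψ(b₊) − ψ(b₋)|² − (4/3)d⁴(Nc²/n²)(n²θ)²·Σ_{y∈Ω^{(k)}}|ψ(y)|² ≤ Re ψᴴΔ_k(Ω,u)ψ` (NO smallness
  hypothesis on `θ`: for `d³(n²θ)² > ½` the claim follows from `Δ_k(Ω,u) ≥ 0` and `E ≤ 4d‖ψ‖²`); **`ineq732_smallField_region_phys`** (printed `a_k`,
  `c = cPhys`: `γ = min(a/(9(d+1)), 1/12)`, error `(4/3)d⁴(L^{2k}θ)²`, `1 ≤ k`).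
* §6 `innerK_univ`, **`ineq732_smallField_univ`** (`Ω = T`, all unit bonds and sites), (private) `dN_smul`, `nOp_smul`, **`gBox_smul`**,
  **`deltaRegion_smul`**, `re_form_deltaRegion_smul`, **`ineq238_deltaRegion_smallField_region`** (gen 15's `deltaRegion (α_kL^{kd}) ε^{−1} u k Ω` at
  level `0`, factor `A/a_k`).
HONEST SCOPE.  (i) FIRST printed form (`u_k(b)` in the covariant derivative of `ψ`, `u_k = lineIter u k`, p11's convention); the second form
(`v_b`) differs by the defect `u_k(b)v_b^{−1}` and is not treated here (p33's `BIJ85Ineq732Background*` treat it at `Ω = T` for the (4.5.4)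
backgrounds).  (ii) The hypothesis is the `η`-lattice plaquette smallness `|u(∂p) − 1| ≤ θ` with error `∝ (L^{2k}θ)²` — the print's (7.3.1) is placed
on the unit-lattice field `v`, and *"u smooth"* of (2.38) includes Hölder control; deriving `L^{2k}θ ≲ e_k𝓅(e_k)` for the backgrounds of record is
Sect. 7.2 / row C1.Eq7.2.2 (p33's `theta_of_hyp731_closed` at `Ω = T`), NOT done here (HOME/GAPS.md G-C1-05 stands as narrowed by p11/p33).  (iii)
REGION FORM ONLY: this is (I.7.3.2)/[7] (1.22) for `Δ_k(Ω,u)`, NOT (2.38) for `Δ_{k,loc}(u)` (which needs the non-flat (2.35), not in the tree); the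
error sum is over `Ω^{(k)}` and the bond sum over `Ω^{(k)*}` ([7]'s `Σ_{⟨x,x′⟩⊂Ω^{(k)}}`); no `m²` term (`m² = 0` in [I]).  (iv) Constants not optimized,
depend on `(a, d)` only; every `d ≥ 1`, `L ≥ 3` (the series' tori), every volume, standing range `j + k ≤ m + K`; `1 ≤ k` only for the `_phys` /
counting forms (printed `a_k`).  DIVERGENCE OF METHOD: elementary multiscale Poincaré/averaging inequalities with holonomy defects (p11's route),
not the unprinted *"extension of the proofs of [7]"* via a local axial gauge and [7]'s random walk.
Imports: gen 18's `BIJ85Ineq732FlatRegion` (→ gen 15's `BIJ88DeltaLoc234Torus`, `BIJ88NeumannPropagator227Torus`, `BIJ88NeumannNoZeroModesTorus`),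
p11 gen 5's `BIJ85Ineq732General` (→ `BIJ85CovariantPoincare`, `BIJ85HolonomyDefect`, `BIJ85AbelianStokes`, gen 4's `BIJ85BlockAveragingIneqCov`),
pv07's `B1RG242Torus` (`α`).  Literature + Mathlib only.  Unit `lit-balaban-p31` (literature-prover-lit-balaban-p31-g20-0), 2026-08-23.  NOT summit
progress.
-/

open scoped BigOperators Matrix ComplexConjugate
open Finset Matrix

namespace Literature.MathematicalPhysics.QuantumFieldTheory.BalabanImbrieJaffe1984to88.BIJ85Ineq732SmallFieldRegion

open Literature.MathematicalPhysics.QuantumFieldTheory.Balaban1983to89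
open BIJ88Sect3Statements (U1 toC cfg covD starB mem_starB toC_mul toC_one toC_inv norm_toC)
open BIJ85Sect1Model (HiggsField)
open BIJ85BlockAveragesTorus BIJ85BlockAveragesTorusK BIJ85BlockAveragingIneq BIJ85BlockAveragingIneqCov
open BIJ85AbelianStokes (plaqC norm_plaqC_lineIter_sub_one_le)
open BIJ85HolonomyDefect (norm_blockContourDefect_sub_one_le')
open BIJ85CovariantPoincare (covPoincare_block massBound_step_real)
open BIJ88NeumannNoZeroModesTorus (IsBlockUnion innerK mem_innerK mem_innerK_zero block_subset_innerK blockK_subset_blockK_succ)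
open BIJ88NeumannPropagator227Torus
open BIJ88DeltaLoc234Torus (qMatT qMatT_apply qMatT_mulVec deltaRegion)
open BIJ85Ineq732FlatRegion (form_deltaRegion_eq_energy runBond_mem_starB runSite_mem_of_blockK_subset sum_starB_eq_sum_ite
  sum_norm_cov_sub_sq_add_le gBox_mulVec_apply_eq_zero)

noncomputable section

variable {P : Params} {j : ℕ}

/-! ## §0 Region bookkeeping: inner sites level by level, block unions down the levels, sums over a block union -/

/-- kernel: **the inner sites nest one level at a time** — `y ∈ Ω^{(i+1)}` iff its block `B(y)` consists of level-`i` inner sites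
(`B^{i+1}(y) = ⋃_{z∈B(y)} B^i(z)`). [cite: BalabanImbrieJaffe1988, (2.27) p.263] -/
theorem mem_innerK_succ_iff {i : ℕ} {Ω : Finset (Balaban1983to89.Site P j)} {y : Balaban1983to89.Site P (j+i+1)} :
    y ∈ innerK (i+1) Ω ↔ block y ⊆ innerK i Ω := by
  constructor
  · exact fun hy => block_subset_innerK hy
  · intro h
    rw [mem_innerK, blockK_succ]
    intro x hx
    obtain ⟨z, hz, hxz⟩ := mem_biUnion.1 hx
    exact mem_innerK.1 (h hz) hxz

/-- kernel: a `k`-block union is an `i`-block union for every `i ≤ k`. [cite: BalabanImbrieJaffe1988, (2.27) p.263] -/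
theorem isBlockUnion_of_le {i k : ℕ} (hik : i ≤ k) {Ω : Finset (Balaban1983to89.Site P j)} (hΩ : IsBlockUnion k Ω) :
    IsBlockUnion i Ω := by
  induction k with
  | zero =>
    have hi : i = 0 := Nat.le_zero.1 hik
    subst hi; exact hΩ
  | succ k ih =>
    rcases Nat.lt_or_eq_of_le hik with h | h
    · exact ih (Nat.lt_succ_iff.1 h) hΩ.of_succ
    · subst h; exact hΩ

/-- kernel: **block unions propagate down the levels** — if `Ω` is a union of `(i+1)`-blocks then its level-`i` inner sites `Ω^{(i)}`
form a union of blocks of `T^{(i)}` (standing range). [cite: BalabanImbrieJaffe1988, (2.27) p.263] -/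
theorem isBlockUnion_one_innerK {i : ℕ} (hi : j + i + 1 ≤ P.m + P.K) {Ω : Finset (Balaban1983to89.Site P j)}
    (hΩ : IsBlockUnion (i+1) Ω) : IsBlockUnion 1 (innerK i Ω) := by
  intro y hy y' hy'
  rw [blkIter_succ, blkIter_zero, blockK_succ] at hy'
  simp only [mem_biUnion, blockK_zero, mem_singleton] at hy'
  obtain ⟨z, hz, hz'⟩ := hy'
  subst hz'
  -- a point of `B^i(y) ⊆ Ω`
  have hxy : cornerIter i y ∈ blockK i y := mem_blockK.2 (blkIter_cornerIter i (by omega) y)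
  have hx : cornerIter i y ∈ Ω := mem_innerK.1 hy hxy
  have hbig := hΩ _ hx
  rw [blkIter_succ, mem_blockK.1 hxy] at hbig
  exact mem_innerK.2 ((blockK_subset_blockK_succ i hz).trans hbig)

/-- kernel: **a block union is the disjoint union of the blocks of its inner sites**: `Σ_{x∈Ω} F(x) = Σ_{y∈Ω^{(k)}} Σ_{x∈B^k(y)} F(x)`.
[cite: BalabanImbrieJaffe1988, (2.27) p.263] -/
theorem sum_region_eq_sum_innerK {k : ℕ} {Ω : Finset (Balaban1983to89.Site P j)} (hΩ : IsBlockUnion k Ω) {α : Type*} [AddCommMonoid α]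
    (F : Balaban1983to89.Site P j → α) : ∑ x ∈ Ω, F x = ∑ y ∈ innerK k Ω, ∑ x ∈ blockK k y, F x := by
  have hΩeq : Ω = (innerK k Ω).biUnion (fun y => blockK k y) := by
    ext x
    rw [mem_biUnion]
    constructor
    · exact fun hx => ⟨blkIter k x, mem_innerK.2 (hΩ x hx), mem_blockK_blkIter k x⟩
    · rintro ⟨y, hy, hx⟩
      exact mem_innerK.1 hy hx
  conv_lhs => rw [hΩeq]
  exact sum_biUnion (pairwiseDisjoint_blockK k _)

/-- kernel: `B^1(y) = ⋃_{z∈B(y)} {z} = B(y)`. [cite: BalabanImbrieJaffe1985, (2.4) p.302] -/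
theorem blockK_one {i : ℕ} (y : Balaban1983to89.Site P (i+0+1)) : blockK (j := i) 1 y = block y := by
  rw [blockK_succ]
  ext z
  simp only [mem_biUnion, blockK_zero, mem_singleton]
  constructor
  · rintro ⟨w, hw, rfl⟩; exact hw
  · exact fun hz => ⟨z, hz, rfl⟩

/-- kernel: the one-level case — `Σ_{z∈X} F(z) = Σ_{y∈X^{(1)}} Σ_{z∈B(y)} F(z)` for a union `X` of blocks. [cite: BalabanImbrieJaffe1988, (2.27) p.263] -/
theorem sum_region_eq_sum_innerK_one {i : ℕ} {X : Finset (Balaban1983to89.Site P i)} (hX : IsBlockUnion 1 X) {α : Type*}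
    [AddCommMonoid α] (F : Balaban1983to89.Site P i → α) : ∑ z ∈ X, F z = ∑ y ∈ innerK 1 X, ∑ z ∈ block y, F z := by
  rw [sum_region_eq_sum_innerK hX]
  exact sum_congr rfl fun y _ => by rw [blockK_one]

/-- kernel: for a nonnegative `F`, the sum over the blocks of the inner sites is at most the sum over `Ω` (any `Ω`).
[cite: BalabanImbrieJaffe1988, (2.27) p.263] -/
theorem sum_innerK_blockK_le {k : ℕ} (Ω : Finset (Balaban1983to89.Site P j)) {F : Balaban1983to89.Site P j → ℝ} (hF : ∀ x, 0 ≤ F x) :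
    ∑ y ∈ innerK k Ω, ∑ x ∈ blockK k y, F x ≤ ∑ x ∈ Ω, F x := by
  rw [← sum_biUnion (pairwiseDisjoint_blockK k _)]
  refine sum_le_sum_of_subset_of_nonneg (fun x hx => ?_) fun _ _ _ => hF _
  obtain ⟨y, hy, hxy⟩ := mem_biUnion.1 hx
  exact mem_innerK.1 hy hxy

/-! ## §1 The covariant block-averaging inequality with holonomy defect, ONE COARSE BOND AT A TIME (the kernel of p11's
`BIJ85BlockAveragingIneqCov.sum_norm_qCovK_shift_sub_sq_le_cov`, exported) -/

/-- `|a + b|² ≤ 2|a|² + 2|b|²`. [folklore] -/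
private theorem norm_add_sq_le_two (a b : ℂ) : ‖a + b‖ ^ 2 ≤ 2 * ‖a‖ ^ 2 + 2 * ‖b‖ ^ 2 := by
  have h1 : ‖a + b‖ ^ 2 ≤ (‖a‖ + ‖b‖) ^ 2 := pow_le_pow_left₀ (norm_nonneg _) (norm_add_le a b) 2
  nlinarith [sq_nonneg (‖a‖ - ‖b‖)]

/-- Jensen / Cauchy–Schwarz on a finite set: `|Σ_{x∈S} a_x|² ≤ |S|·Σ_{x∈S}|a_x|²`. [folklore] -/
private theorem norm_sum_sq_le_card_mul {ι : Type*} (S : Finset ι) (a : ι → ℂ) :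
    ‖∑ x ∈ S, a x‖ ^ 2 ≤ S.card * ∑ x ∈ S, ‖a x‖ ^ 2 :=
  calc ‖∑ x ∈ S, a x‖ ^ 2 ≤ (∑ x ∈ S, ‖a x‖) ^ 2 := pow_le_pow_left₀ (norm_nonneg _) (norm_sum_le _ _) 2
    _ ≤ S.card * ∑ x ∈ S, ‖a x‖ ^ 2 := sq_sum_le_card_mul_sum_sq

/-- kernel (one term): with `h = u(Γ^{(k)}_{·})` the composite transports, `W` a number on the coarse bond, `r` the run transport and
`ρ := h(x)^{−1}·W·h(x′)·r^{−1}` the HOLONOMY DEFECT of the closed contour (`x′ = x + L^ke_μ`; the loop of (2.10) at level `k`):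
`|W·h(x′)φ(x′) − h(x)φ(x)|² ≤ 2|r·φ(x′) − φ(x)|² + 2|ρ − 1|²|φ(x′)|²` (`|h| = |r| = 1`; p11's private kernel, restated).
[cite: BalabanImbrieJaffe1985, (2.10) p.303] -/
private theorem norm_defect_term_sq_le {h h' W r φ' φ0 : ℂ} (hh : ‖h‖ = 1) (hr : ‖r‖ = 1) :
    ‖W * (h' * φ') - h * φ0‖ ^ 2 ≤ 2 * ‖r * φ' - φ0‖ ^ 2 + 2 * (‖h⁻¹ * W * h' * r⁻¹ - 1‖ ^ 2 * ‖φ'‖ ^ 2) := by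
  have hne : h ≠ 0 := fun e => by simp [e] at hh
  have rne : r ≠ 0 := fun e => by simp [e] at hr
  have e1 : W * (h' * φ') - h * φ0 = h * ((r * φ' - φ0) + (h⁻¹ * W * h' * r⁻¹ - 1) * (r * φ')) := by
    field_simp
    ring
  rw [e1, norm_mul, hh, one_mul]
  refine (norm_add_sq_le_two _ _).trans ?_
  rw [norm_mul, norm_mul, hr, one_mul, mul_pow]

/-- **THE COVARIANT BLOCK-AVERAGING INEQUALITY WITH HOLONOMY DEFECT, ONE COARSE BOND** (general background `u`, any unit field `W` on the
coarse bonds, standing range; `n = L^k`, `N = L^{kd}`): for every `φ : T_η → ℂ`, every coarse site `y` and direction `μ`,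
`|W(⟨y,y+e_μ⟩)(Q_k(u)φ)(y+e_μ) − (Q_k(u)φ)(y)|² ≤ N^{−1}Σ_{x∈B^k(y)}[2n·Σ_{t<n}|u(b_t)φ(x+(t+1)e_μ) − φ(x+te_μ)|² + 2|ρ_μ(x) − 1|²|φ(x+ne_μ)|²]`
with `ρ_μ(x) = u(Γ^{(k)}_x)^{−1}·W·u(Γ^{(k)}_{x+ne_μ})·u(run_{x,μ,n})^{−1}` (Jensen over the block, the pairing `x ↔ x + ne_μ` of `B^k(y)` with
`B^k(y+e_μ)`, covariant telescoping `norm_runProd_mul_sub_sq_le` along the straight run) — the `have hB` inside p11's whole-torus theorem, made a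
statement so that it can be summed over the coarse bonds of a REGION. [cite: BalabanImbrieJaffe1985, (7.3.2) p.326] -/
theorem norm_qCovK_shift_sub_sq_le_cov {k : ℕ} (hk : j + k ≤ P.m + P.K) (U : GaugeField P j U1) (W : GaugeField P (j+k) U1)
    (φ : HiggsField P j) (y : Balaban1983to89.Site P (j+k)) (μ : Fin P.d) :
    ‖toC (W ⟨y, μ⟩) * qCovK U k φ (y.shift μ) - qCovK U k φ y‖ ^ 2
      ≤ ((P.L : ℝ) ^ (k * P.d))⁻¹ * ∑ x ∈ blockK k y,
          (2 * ((P.L ^ k : ℕ) * ∑ t ∈ range (P.L ^ k), ‖toC (U (runBond x μ t)) * φ ((runSite x μ t).shift μ) - φ (runSite x μ t)‖ ^ 2)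
            + 2 * (‖(holCK U k x)⁻¹ * toC (W ⟨blkIter k x, μ⟩) * holCK U k (runSite x μ (P.L ^ k))
                * (toC (runProd U x μ (P.L ^ k)))⁻¹ - 1‖ ^ 2 * ‖φ (runSite x μ (P.L ^ k))‖ ^ 2)) := by
  set n : ℕ := P.L ^ k with hn
  set N : ℝ := (P.L : ℝ) ^ (k * P.d) with hN
  have hNpos : 0 < N := pow_pos (Nat.cast_pos.2 P.L_pos) _
  rw [qCovK_apply, qCovK_apply, sum_blockK_shift hk, ← mul_assoc, mul_comm (toC (W ⟨y, μ⟩)), mul_assoc, ← mul_sub, mul_sum,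
    ← sum_sub_distrib, norm_mul, mul_pow, norm_inv, norm_pow, Complex.norm_natCast, Nat.cast_pow]
  have h1 := norm_sum_sq_le_card_mul (blockK k y)
    (fun x => toC (W ⟨y, μ⟩) * (holCK U k (runSite x μ n) * φ (runSite x μ n)) - holCK U k x * φ x)
  rw [card_blockK k hk y, Nat.cast_pow] at h1
  have h2 : ∑ x ∈ blockK k y, ‖toC (W ⟨y, μ⟩) * (holCK U k (runSite x μ n) * φ (runSite x μ n)) - holCK U k x * φ x‖ ^ 2
      ≤ ∑ x ∈ blockK k y, (2 * ((n : ℝ) * ∑ t ∈ range n, ‖toC (U (runBond x μ t)) * φ ((runSite x μ t).shift μ) - φ (runSite x μ t)‖ ^ 2)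
          + 2 * (‖(holCK U k x)⁻¹ * toC (W ⟨blkIter k x, μ⟩) * holCK U k (runSite x μ n)
                * (toC (runProd U x μ n))⁻¹ - 1‖ ^ 2 * ‖φ (runSite x μ n)‖ ^ 2)) := by
    refine sum_le_sum fun x hx => ?_
    have hy : blkIter k x = y := mem_blockK.1 hx
    have h3 := norm_defect_term_sq_le (h' := holCK U k (runSite x μ n)) (W := toC (W ⟨y, μ⟩))
      (φ' := φ (runSite x μ n)) (φ0 := φ x) (norm_holCK U k x) (norm_toC (runProd U x μ n))
    refine h3.trans (add_le_add (mul_le_mul_of_nonneg_left (norm_runProd_mul_sub_sq_le U φ x μ n) (by norm_num)) ?_)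
    rw [hy]
  have h12 := h1.trans (mul_le_mul_of_nonneg_left h2 hNpos.le)
  refine (mul_le_mul_of_nonneg_left h12 (by positivity)).trans (le_of_eq ?_)
  rw [← hN, pow_two, mul_assoc, ← mul_assoc N⁻¹ N, inv_mul_cancel₀ hNpos.ne', one_mul, hn, Nat.cast_pow]

/-! ## §2 The covariant block-averaging inequality ON A REGION: the unit bond form of `Q_k(u)φ` over `Ω^{(k)}` against the fine covariant
bond form over `Ω`, with the defect measured by `Σ_{x∈Ω}|φ(x)|²` -/

/-- Sums over the torus are invariant under the translation `x ↦ x + te_μ`. [folklore] -/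
private theorem sum_runSite_eq (μ : Fin P.d) :
    ∀ (t : ℕ) (F : Balaban1983to89.Site P j → ℝ), ∑ x : Balaban1983to89.Site P j, F (runSite x μ t) = ∑ x : Balaban1983to89.Site P j, F x
  | 0, F => by simp only [runSite_zero]
  | t + 1, F => by
    have h := sum_runSite_eq μ t (fun z => F (z.shift μ))
    simp only [runSite_shift] at h
    rw [h]
    exact Equiv.sum_comp (LatticeFieldCalculus.shiftEquiv (P := P) (j := j) μ) F

/-- kernel (counting): `Σ_y Σ_μ Σ_{x∈B^k(y)} Σ_{t<n} F_μ(x + te_μ) = n·Σ_x Σ_μ F_μ(x)` — the blocks partition the torus and each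
translation is a bijection. [folklore] -/
private theorem sum_blocks_runs {k : ℕ} (n : ℕ) (F : Fin P.d → Balaban1983to89.Site P j → ℝ) :
    ∑ y : Balaban1983to89.Site P (j+k), ∑ μ : Fin P.d, ∑ x ∈ blockK k y, ∑ t ∈ range n, F μ (runSite x μ t)
      = n * ∑ x : Balaban1983to89.Site P j, ∑ μ : Fin P.d, F μ x := by
  rw [sum_comm, sum_comm (s := (univ : Finset (Balaban1983to89.Site P j))), mul_sum]
  refine sum_congr rfl fun μ _ => ?_
  rw [sum_blockK_sum (k := k) (fun x => ∑ t ∈ range n, F μ (runSite x μ t)), sum_comm,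
    sum_congr rfl fun t _ => sum_runSite_eq μ t (F μ), sum_const, card_range, nsmul_eq_mul]

/-- kernel (counting): `Σ_y Σ_μ Σ_{x∈B^k(y)} G_μ(x, x + ne_μ) = Σ_x Σ_μ G_μ(x, x + ne_μ)` (the blocks partition the torus). [folklore] -/
private theorem sum_blocks_eq {k : ℕ} (G : Fin P.d → Balaban1983to89.Site P j → ℝ) :
    ∑ y : Balaban1983to89.Site P (j+k), ∑ μ : Fin P.d, ∑ x ∈ blockK k y, G μ x
      = ∑ x : Balaban1983to89.Site P j, ∑ μ : Fin P.d, G μ x := by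
  rw [sum_comm, sum_comm (s := (univ : Finset (Balaban1983to89.Site P j)))]
  exact sum_congr rfl fun μ _ => sum_blockK_sum (k := k) (G μ)

/-- **THE COVARIANT BLOCK-AVERAGING INEQUALITY WITH HOLONOMY DEFECT ON A REGION** (general background `u`, any unit field `W` on the
coarse bonds, standing range): if the block-contour holonomy defect obeys `|ρ_μ(x) − 1| ≤ ρ̄` for every `x, μ`, then for every
`φ : T_η → ℂ` and every `Ω ⊂ T_η`,
`Σ_{⟨y,y+e_μ⟩ ⊂ Ω^{(k)}} |W_{⟨y,y+e_μ⟩}(Q_k(u)φ)(y+e_μ) − (Q_k(u)φ)(y)|² ≤ 2(n²/N)·Σ_{b⊂Ω} |u_bφ(b₊) − φ(b₋)|² + 2N^{−1}ρ̄²·d·Σ_{x∈Ω} |φ(x)|²`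
(`n = L^k`, `N = L^{kd}`; `Ω^{(k)}` = the unit-lattice sites whose `k`-block lies in `Ω`): §1 on every coarse bond of `Ω^{(k)}`, the straight runs
from `B^k(y)` staying inside `Ω` (gen 18's `runBond_mem_starB`), each fine bond of `Ω` serving at most `n` (point, step) pairs, and
`x + ne_μ ∈ B^k(y+e_μ) ⊆ Ω`, each site met once per direction.  p11's whole-torus `sum_norm_qCovK_shift_sub_sq_le_cov` is `Ω = T`.
[cite: BalabanImbrieJaffe1985, (7.3.2) p.326] -/
theorem sum_norm_qCovK_shift_sub_sq_region_le_cov {k : ℕ} (hk : j + k ≤ P.m + P.K) (U : GaugeField P j U1)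
    (W : GaugeField P (j+k) U1) {ρ : ℝ}
    (hρ : ∀ (x : Balaban1983to89.Site P j) (μ : Fin P.d),
      ‖(holCK U k x)⁻¹ * toC (W ⟨blkIter k x, μ⟩) * holCK U k (runSite x μ (P.L ^ k)) * (toC (runProd U x μ (P.L ^ k)))⁻¹ - 1‖ ≤ ρ)
    (Ω : Finset (Balaban1983to89.Site P j)) (φ : HiggsField P j) :
    ∑ b ∈ starB (innerK k Ω), ‖toC (W b) * qCovK U k φ b.tgt - qCovK U k φ b.src‖ ^ 2
      ≤ 2 * (((P.L : ℝ) ^ k) ^ 2 / (P.L : ℝ) ^ (k * P.d)) * ∑ b ∈ starB Ω, ‖toC (U b) * φ b.tgt - φ b.src‖ ^ 2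
        + 2 * ((P.L : ℝ) ^ (k * P.d))⁻¹ * ρ ^ 2 * (P.d * ∑ x ∈ Ω, ‖φ x‖ ^ 2) := by
  set n : ℕ := P.L ^ k with hn
  set N : ℝ := (P.L : ℝ) ^ (k * P.d) with hN
  have hNpos : 0 < N := pow_pos (Nat.cast_pos.2 P.L_pos) _
  -- the fine kinetic integrand restricted to `Ω*` and the defect integrand restricted to `Ω`
  set F : Fin P.d → Balaban1983to89.Site P j → ℝ := fun μ z =>
    if z ∈ Ω ∧ z.shift μ ∈ Ω then ‖toC (U ⟨z, μ⟩) * φ (z.shift μ) - φ z‖ ^ 2 else 0 with hF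
  set G : Fin P.d → Balaban1983to89.Site P j → ℝ := fun μ x =>
    if runSite x μ n ∈ Ω then ‖φ (runSite x μ n)‖ ^ 2 else 0 with hG
  have hF0 : ∀ μ z, 0 ≤ F μ z := fun μ z => by simp only [hF]; split_ifs <;> positivity
  have hG0 : ∀ μ x, 0 ≤ G μ x := fun μ x => by simp only [hG]; split_ifs <;> positivity
  -- one coarse bond of `Ω^{(k)}`
  have hterm : ∀ (y : Balaban1983to89.Site P (j+k)) (μ : Fin P.d),
      (if y ∈ innerK k Ω ∧ y.shift μ ∈ innerK k Ω then ‖toC (W ⟨y, μ⟩) * qCovK U k φ (y.shift μ) - qCovK U k φ y‖ ^ 2 else 0)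
        ≤ N⁻¹ * ∑ x ∈ blockK k y, (2 * ((n : ℝ) * ∑ t ∈ range n, F μ (runSite x μ t)) + 2 * (ρ ^ 2 * G μ x)) := by
    intro y μ
    split_ifs with hyy
    · obtain ⟨hy, hy'⟩ := hyy
      rw [mem_innerK] at hy hy'
      refine (norm_qCovK_shift_sub_sq_le_cov hk U W φ y μ).trans ?_
      rw [← hN]
      refine mul_le_mul_of_nonneg_left (sum_le_sum fun x hx => add_le_add ?_ ?_) (inv_nonneg.2 hNpos.le)
      · refine mul_le_mul_of_nonneg_left (mul_le_mul_of_nonneg_left (le_of_eq (sum_congr rfl fun t ht => ?_)) (Nat.cast_nonneg _))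
          (by norm_num)
        have hb := runBond_mem_starB hk hy hy' hx (mem_range.1 ht)
        rw [mem_starB, runBond_tgt] at hb
        simp only [hF]
        rw [runSite_shift, if_pos ⟨hb.1, hb.2⟩]
        rfl
      · refine mul_le_mul_of_nonneg_left ?_ (by norm_num)
        have hxn : runSite x μ n ∈ Ω := runSite_mem_of_blockK_subset hk hy hy' hx le_rfl
        simp only [hG, if_pos hxn]
        exact mul_le_mul_of_nonneg_right (pow_le_pow_left₀ (norm_nonneg _) (hρ x μ) 2) (sq_nonneg _)
    · exact mul_nonneg (inv_nonneg.2 hNpos.le) (sum_nonneg fun x _ => add_nonneg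
        (mul_nonneg (by norm_num) (mul_nonneg (Nat.cast_nonneg _) (sum_nonneg fun _ _ => hF0 _ _)))
        (mul_nonneg (by norm_num) (mul_nonneg (sq_nonneg _) (hG0 _ _))))
  -- the counting identities
  have keyF := sum_blocks_runs (k := k) n F
  have keyG := sum_blocks_eq (k := k) (fun μ x => ρ ^ 2 * G μ x)
  have hFsum : ∑ x : Balaban1983to89.Site P j, ∑ μ : Fin P.d, F μ x = ∑ b ∈ starB Ω, ‖toC (U b) * φ b.tgt - φ b.src‖ ^ 2 := by
    rw [sum_starB_eq_sum_ite]
    rfl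
  have hGsum : ∑ x : Balaban1983to89.Site P j, ∑ μ : Fin P.d, ρ ^ 2 * G μ x ≤ ρ ^ 2 * (P.d * ∑ x ∈ Ω, ‖φ x‖ ^ 2) := by
    rw [sum_comm]
    have e : ∀ μ : Fin P.d, ∑ x : Balaban1983to89.Site P j, ρ ^ 2 * G μ x = ρ ^ 2 * ∑ x ∈ Ω, ‖φ x‖ ^ 2 := by
      intro μ
      rw [← mul_sum, sum_runSite_eq μ n (fun z => if z ∈ Ω then ‖φ z‖ ^ 2 else 0), ← Finset.sum_filter]
      simp only [filter_mem_eq_inter, univ_inter]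
    simp only [e, sum_const, card_univ, Fintype.card_fin, nsmul_eq_mul]
    exact le_of_eq (by ring)
  calc ∑ b ∈ starB (innerK k Ω), ‖toC (W b) * qCovK U k φ b.tgt - qCovK U k φ b.src‖ ^ 2
      = ∑ y : Balaban1983to89.Site P (j+k), ∑ μ : Fin P.d,
          (if y ∈ innerK k Ω ∧ y.shift μ ∈ innerK k Ω then
            ‖toC (W ⟨y, μ⟩) * qCovK U k φ (y.shift μ) - qCovK U k φ y‖ ^ 2 else 0) := sum_starB_eq_sum_ite _ _
    _ ≤ ∑ y : Balaban1983to89.Site P (j+k), ∑ μ : Fin P.d,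
          N⁻¹ * ∑ x ∈ blockK k y, (2 * ((n : ℝ) * ∑ t ∈ range n, F μ (runSite x μ t)) + 2 * (ρ ^ 2 * G μ x)) :=
        sum_le_sum fun y _ => sum_le_sum fun μ _ => hterm y μ
    _ = N⁻¹ * (2 * (n : ℝ) * ∑ y : Balaban1983to89.Site P (j+k), ∑ μ : Fin P.d, ∑ x ∈ blockK k y, ∑ t ∈ range n, F μ (runSite x μ t)
          + 2 * ∑ y : Balaban1983to89.Site P (j+k), ∑ μ : Fin P.d, ∑ x ∈ blockK k y, ρ ^ 2 * G μ x) := by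
        simp_rw [← mul_sum, sum_add_distrib, ← mul_sum, mul_sum, ← mul_assoc]
    _ = N⁻¹ * (2 * (n : ℝ) * ((n : ℝ) * ∑ b ∈ starB Ω, ‖toC (U b) * φ b.tgt - φ b.src‖ ^ 2)
          + 2 * ∑ x : Balaban1983to89.Site P j, ∑ μ : Fin P.d, ρ ^ 2 * G μ x) := by rw [keyF, keyG, hFsum]
    _ ≤ N⁻¹ * (2 * (n : ℝ) * ((n : ℝ) * ∑ b ∈ starB Ω, ‖toC (U b) * φ b.tgt - φ b.src‖ ^ 2)
          + 2 * (ρ ^ 2 * (P.d * ∑ x ∈ Ω, ‖φ x‖ ^ 2))) := by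
        refine mul_le_mul_of_nonneg_left (add_le_add le_rfl (mul_le_mul_of_nonneg_left hGsum (by norm_num))) (inv_nonneg.2 hNpos.le)
    _ = _ := by
        rw [hN, hn]
        push_cast
        field_simp

/-! ## §3 Region forms of Jensen, of the tail count and of the one-level covariant Poincaré inequality -/

/-- kernel: `Ω^{(i+1)} = (Ω^{(i)})^{(1)}` as finite sets. [cite: BalabanImbrieJaffe1988, (2.27) p.263] -/
theorem innerK_succ_eq {i : ℕ} (Ω : Finset (Balaban1983to89.Site P j)) : innerK (i+1) Ω = innerK 1 (innerK i Ω) := by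
  ext y
  rw [mem_innerK_succ_iff, mem_innerK, blockK_one]

/-- kernel: `Ω^{(0)} = Ω`. [cite: BalabanImbrieJaffe1988, (2.27) p.263] -/
theorem innerK_zero_eq (Ω : Finset (Balaban1983to89.Site P j)) : innerK 0 Ω = Ω := by
  ext y; exact mem_innerK_zero

/-- **Jensen for the `k`-fold covariant average, on a region**: `Σ_{y∈Ω^{(k)}}|(Q_k(u)φ)(y)|² ≤ N^{−1}Σ_{x∈Ω}|φ(x)|²` (`|u(Γ^{(k)})| = 1`,
`|B^k(y)| = N`; the blocks of the inner sites lie in `Ω`; p11's `sum_norm_qCovK_sq_le` is `Ω = T`). [cite: BalabanImbrieJaffe1985, (2.6) p.303] -/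
theorem sum_norm_qCovK_sq_region_le {k : ℕ} (hk : j + k ≤ P.m + P.K) (U : GaugeField P j U1) (Ω : Finset (Balaban1983to89.Site P j))
    (φ : HiggsField P j) :
    ∑ y ∈ innerK k Ω, ‖qCovK U k φ y‖ ^ 2 ≤ ((P.L : ℝ) ^ (k * P.d))⁻¹ * ∑ x ∈ Ω, ‖φ x‖ ^ 2 := by
  have hN : (0 : ℝ) < (P.L : ℝ) ^ (k * P.d) := pow_pos (Nat.cast_pos.2 P.L_pos) _
  have hy : ∀ y : Balaban1983to89.Site P (j+k),
      ‖qCovK U k φ y‖ ^ 2 ≤ ((P.L : ℝ) ^ (k * P.d))⁻¹ * ∑ x ∈ blockK k y, ‖φ x‖ ^ 2 := by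
    intro y
    rw [qCovK_apply, norm_mul, mul_pow, norm_inv, norm_pow, Complex.norm_natCast]
    have h1 := norm_sum_sq_le_card_mul (blockK k y) (fun x => holCK U k x * φ x)
    rw [card_blockK k hk y, Nat.cast_pow] at h1
    simp only [norm_mul, norm_holCK, one_mul] at h1
    calc ((P.L : ℝ) ^ (k * P.d))⁻¹ ^ 2 * ‖∑ x ∈ blockK k y, holCK U k x * φ x‖ ^ 2
        ≤ ((P.L : ℝ) ^ (k * P.d))⁻¹ ^ 2 * ((P.L : ℝ) ^ (k * P.d) * ∑ x ∈ blockK k y, ‖φ x‖ ^ 2) :=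
          mul_le_mul_of_nonneg_left h1 (by positivity)
      _ = _ := by field_simp
  calc ∑ y ∈ innerK k Ω, ‖qCovK U k φ y‖ ^ 2
      ≤ ∑ y ∈ innerK k Ω, ((P.L : ℝ) ^ (k * P.d))⁻¹ * ∑ x ∈ blockK k y, ‖φ x‖ ^ 2 := sum_le_sum fun y _ => hy y
    _ = ((P.L : ℝ) ^ (k * P.d))⁻¹ * ∑ y ∈ innerK k Ω, ∑ x ∈ blockK k y, ‖φ x‖ ^ 2 := by rw [mul_sum]
    _ ≤ _ := mul_le_mul_of_nonneg_left (sum_innerK_blockK_le Ω fun _ => sq_nonneg _) (inv_nonneg.2 hN.le)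

/-- kernel: **the final points of the bonds of `X*` are met at most `d` times each**: `Σ_{b∈X*} f(b₊) ≤ d·Σ_{x∈X} f(x)` for `f ≥ 0`.
[cite: BalabanImbrieJaffe1988, (3.5) p.266] -/
theorem sum_starB_tgt_le {i : ℕ} (X : Finset (Balaban1983to89.Site P i)) {f : Balaban1983to89.Site P i → ℝ} (hf : ∀ x, 0 ≤ f x) :
    ∑ b ∈ starB X, f b.tgt ≤ P.d * ∑ x ∈ X, f x := by
  rw [sum_starB_eq_sum_ite]
  have hG : ∀ μ : Fin P.d, ∑ x : Balaban1983to89.Site P i, (if x.shift μ ∈ X then f (x.shift μ) else 0) = ∑ x ∈ X, f x := by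
    intro μ
    have h := sum_runSite_eq (P := P) (j := i) μ 1 (fun z => if z ∈ X then f z else 0)
    simp only [runSite_one] at h
    rw [h, ← Finset.sum_filter, filter_mem_eq_inter, univ_inter]
  calc ∑ x : Balaban1983to89.Site P i, ∑ μ : Fin P.d, (if x ∈ X ∧ x.shift μ ∈ X then f (PBond.tgt ⟨x, μ⟩) else 0)
      ≤ ∑ x : Balaban1983to89.Site P i, ∑ μ : Fin P.d, (if x.shift μ ∈ X then f (x.shift μ) else 0) := by
        refine sum_le_sum fun x _ => sum_le_sum fun μ _ => ?_
        by_cases h1 : x ∈ X ∧ x.shift μ ∈ X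
        · rw [if_pos h1, if_pos h1.2]; exact le_rfl
        · rw [if_neg h1]; split_ifs <;> simp [hf]
    _ = ∑ μ : Fin P.d, ∑ x : Balaban1983to89.Site P i, (if x.shift μ ∈ X then f (x.shift μ) else 0) := sum_comm
    _ = ∑ _μ : Fin P.d, ∑ x ∈ X, f x := sum_congr rfl fun μ _ => hG μ
    _ = P.d * ∑ x ∈ X, f x := by rw [sum_const, card_univ, Fintype.card_fin, nsmul_eq_mul]

/-- **THE ONE-LEVEL COVARIANT BLOCK POINCARÉ INEQUALITY WITH DEFECT, ON A REGION**: for a union `X` of blocks of `T^{(i)}`, a bond field `V`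
on `T^{(i)}` whose plaquette variables deviate from `1` by at most `θ′`, and every `g : T^{(i)} → ℂ`,
`Σ_{z∈X}|g(z)|² ≤ L^d·Σ_{y∈X^{(1)}}|(Q(V)g)(y)|² + L(L−1)·(Σ_{b∈X*}|V_bg(b₊) − g(b₋)|² + d(d(L−1)θ′)²·Σ_{z∈X}|g(z)|²)` — p11's per-block
`covPoincare_block` summed over the blocks inside `X` (the intra-block bonds of an inner block lie in `X*`; `sum_starB_tgt_le`); p11's
`covPoincare_oneLevel` is `X = T`. [cite: BalabanImbrieJaffe1985, (7.3.2) p.326] -/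
theorem covPoincare_region {i : ℕ} (hi : i + 1 ≤ P.m + P.K) (V : GaugeField P i U1) {θ' : ℝ}
    (hθ : ∀ (x : Balaban1983to89.Site P i) (μ ν : Fin P.d), ‖plaqC V x μ ν - 1‖ ≤ θ') {X : Finset (Balaban1983to89.Site P i)}
    (hX : IsBlockUnion 1 X) (g : Balaban1983to89.Site P i → ℂ) :
    ∑ z ∈ X, ‖g z‖ ^ 2
      ≤ (P.L : ℝ) ^ P.d * ∑ y ∈ innerK 1 X, ‖qCov V g y‖ ^ 2
        + (P.L : ℝ) * ((P.L : ℝ) - 1) *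
          (∑ b ∈ starB X, ‖toC (V b) * g b.tgt - g b.src‖ ^ 2 + P.d * (P.d * ((P.L : ℝ) - 1) * θ') ^ 2 * ∑ z ∈ X, ‖g z‖ ^ 2) := by
  have hC : 0 ≤ (P.L : ℝ) * ((P.L : ℝ) - 1) := by
    have h1 : (1 : ℝ) ≤ P.L := by exact_mod_cast P.L_pos
    nlinarith
  set F : PBond P i → ℝ := fun b => ‖toC (V b) * g b.tgt - g b.src‖ ^ 2 + (P.d * ((P.L : ℝ) - 1) * θ') ^ 2 * ‖g b.tgt‖ ^ 2 with hF
  have hF0 : ∀ b, 0 ≤ F b := fun b => by positivity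
  -- the intra-block bonds of the inner blocks lie in `X*`
  have hbonds : ∑ y ∈ innerK 1 X, ∑ b ∈ univ.filter (fun b : PBond P i => blockOf b.src = y ∧ blockOf b.tgt = y), F b
      ≤ ∑ b ∈ starB X, F b := by
    rw [← sum_biUnion]
    · refine sum_le_sum_of_subset_of_nonneg (fun b hb => ?_) fun b _ _ => hF0 b
      obtain ⟨y, hy, hb'⟩ := mem_biUnion.1 hb
      simp only [mem_filter, mem_univ, true_and] at hb'
      have hyX : block y ⊆ X := by rw [← blockK_one]; exact mem_innerK.1 hy
      exact (mem_starB X b).2 ⟨hyX (mem_block_iff.2 hb'.1), hyX (mem_block_iff.2 hb'.2)⟩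
    · intro y _ y' _ hyy'
      simp only [Function.onFun]
      rw [Finset.disjoint_filter]
      intro b _ h1 h2
      exact hyy' (h1.1.symm.trans h2.1)
  have hsumF : ∑ b ∈ starB X, F b ≤ ∑ b ∈ starB X, ‖toC (V b) * g b.tgt - g b.src‖ ^ 2
        + P.d * (P.d * ((P.L : ℝ) - 1) * θ') ^ 2 * ∑ z ∈ X, ‖g z‖ ^ 2 := by
    simp only [hF, sum_add_distrib, ← mul_sum]
    refine add_le_add le_rfl ?_
    have h := sum_starB_tgt_le X (f := fun z => ‖g z‖ ^ 2) fun _ => sq_nonneg _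
    calc (P.d * ((P.L : ℝ) - 1) * θ') ^ 2 * ∑ b ∈ starB X, ‖g b.tgt‖ ^ 2
        ≤ (P.d * ((P.L : ℝ) - 1) * θ') ^ 2 * (P.d * ∑ z ∈ X, ‖g z‖ ^ 2) := mul_le_mul_of_nonneg_left h (sq_nonneg _)
      _ = _ := by ring
  calc ∑ z ∈ X, ‖g z‖ ^ 2 = ∑ y ∈ innerK 1 X, ∑ z ∈ block y, ‖g z‖ ^ 2 := sum_region_eq_sum_innerK_one hX _
    _ ≤ ∑ y ∈ innerK 1 X, ((P.L : ℝ) ^ P.d * ‖qCov V g y‖ ^ 2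
        + (P.L : ℝ) * ((P.L : ℝ) - 1) * ∑ b ∈ univ.filter (fun b : PBond P i => blockOf b.src = y ∧ blockOf b.tgt = y), F b) :=
        sum_le_sum fun y _ => covPoincare_block hi V hθ g y
    _ = (P.L : ℝ) ^ P.d * ∑ y ∈ innerK 1 X, ‖qCov V g y‖ ^ 2
        + (P.L : ℝ) * ((P.L : ℝ) - 1) * ∑ y ∈ innerK 1 X,
            ∑ b ∈ univ.filter (fun b : PBond P i => blockOf b.src = y ∧ blockOf b.tgt = y), F b := by
        rw [sum_add_distrib, ← mul_sum, ← mul_sum]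
    _ ≤ _ := add_le_add le_rfl (mul_le_mul_of_nonneg_left (hbonds.trans hsumF) hC)

/-! ## §4 **THE MULTISCALE MASS BOUND ON A REGION** (p11's `BIJ85CovariantPoincare.massBound` localized to a `k`-block union) -/

/-- **THE MULTISCALE MASS BOUND ON A REGION**: for every `U(1)` field `u` on the `η`-lattice torus `T^{(j)}` whose plaquette variables deviate from
`1` by at most `θ`, every `k` with `j + k ≤ m + K`, every union `Ω` of `k`-blocks and every `φ : T^{(j)} → ℂ`, with `n = L^k`, `N = L^{kd}`:
`N^{−1}Σ_{x∈Ω}|φ(x)|² ≤ Σ_{y∈Ω^{(k)}}|(Q_k(u)φ)(y)|² + 2(n²/N)Σ_{b⊂Ω}|u_bφ(b₊) − φ(b₋)|² + d³(n²θ)²·N^{−1}Σ_{x∈Ω}|φ(x)|²` — no constant depends on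
`k`, `L`, the volume, `Ω` or `u`.  Telescoping of the one-level covariant Poincaré inequality on the regions `Ω^{(i)}` (block unions of
`T^{(i)}`, §0) over the levels `i < k` (at level `i`: the field `u^{(i)} = lineIter u i`, plaquettes `≤ L^{2i}θ`; the bond form of `Q_iφ` over
`(Ω^{(i)})*` by §2; Jensen on `Ω`), with p11's real-variable step `massBound_step_real` BY NAME; p11's `massBound` is `Ω = T`.
[cite: BalabanImbrieJaffe1985, (7.3.2) p.326] -/
theorem massBound_region {k : ℕ} (hk : j + k ≤ P.m + P.K) (U : GaugeField P j U1) {θ : ℝ}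
    (hθ : ∀ (x : Balaban1983to89.Site P j) (μ ν : Fin P.d), ‖plaqC U x μ ν - 1‖ ≤ θ)
    {Ω : Finset (Balaban1983to89.Site P j)} (hΩ : IsBlockUnion k Ω) (φ : HiggsField P j) :
    ((P.L : ℝ) ^ (k * P.d))⁻¹ * ∑ x ∈ Ω, ‖φ x‖ ^ 2
      ≤ ∑ y ∈ innerK k Ω, ‖qCovK U k φ y‖ ^ 2
        + 2 * ((P.L : ℝ) ^ k) ^ 2 * ((P.L : ℝ) ^ (k * P.d))⁻¹ * ∑ b ∈ starB Ω, ‖toC (U b) * φ b.tgt - φ b.src‖ ^ 2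
        + (P.d : ℝ) ^ 3 * (((P.L : ℝ) ^ k) ^ 2 * θ) ^ 2
          * (((P.L : ℝ) ^ (k * P.d))⁻¹ * ∑ x ∈ Ω, ‖φ x‖ ^ 2) := by
  have hθ0 : 0 ≤ θ := (norm_nonneg _).trans (hθ default ⟨0, P.hd⟩ ⟨0, P.hd⟩)
  have hL1 : (1 : ℝ) ≤ P.L := by exact_mod_cast P.L_pos
  have hLpos : (0 : ℝ) < P.L := by linarith
  have hd0 : (0 : ℝ) ≤ P.d := Nat.cast_nonneg _
  -- the statement at every level i ≤ k, by induction on i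
  suffices H : ∀ i : ℕ, i ≤ k →
      ((P.L : ℝ) ^ (i * P.d))⁻¹ * ∑ x ∈ Ω, ‖φ x‖ ^ 2
        ≤ ∑ y ∈ innerK i Ω, ‖qCovK U i φ y‖ ^ 2
          + 2 * ((P.L : ℝ) ^ i) ^ 2 * ((P.L : ℝ) ^ (i * P.d))⁻¹ * ∑ b ∈ starB Ω, ‖toC (U b) * φ b.tgt - φ b.src‖ ^ 2
          + (P.d : ℝ) ^ 3 * (((P.L : ℝ) ^ i) ^ 2 * θ) ^ 2
            * (((P.L : ℝ) ^ (i * P.d))⁻¹ * ∑ x ∈ Ω, ‖φ x‖ ^ 2) from H k le_rfl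
  intro i
  induction i with
  | zero =>
    intro _
    obtain ⟨B, hB⟩ : ∃ x : ℝ, x = ∑ b ∈ starB Ω, ‖toC (U b) * φ b.tgt - φ b.src‖ ^ 2 := ⟨_, rfl⟩
    obtain ⟨S, hS⟩ : ∃ x : ℝ, x = ∑ x ∈ Ω, ‖φ x‖ ^ 2 := ⟨_, rfl⟩
    have hB0 : 0 ≤ B := by rw [hB]; exact sum_nonneg fun _ _ => by positivity
    have hS0 : 0 ≤ S := by rw [hS]; exact sum_nonneg fun _ _ => by positivity
    have hq : ∑ y ∈ innerK 0 Ω, ‖qCovK U 0 φ y‖ ^ 2 = S := by rw [innerK_zero_eq, hS]; rfl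
    rw [hq, ← hB, ← hS]
    simp only [zero_mul, pow_zero, inv_one, one_mul, one_pow, mul_one]
    nlinarith [hB0, hS0, sq_nonneg θ, pow_nonneg hd0 3, mul_nonneg (mul_nonneg (pow_nonneg hd0 3) (sq_nonneg θ)) hS0]
  | succ i ih =>
    intro hi
    have hi' : j + i + 1 ≤ P.m + P.K := by omega
    have IH := ih (by omega)
    have hΩi1 : IsBlockUnion (i+1) Ω := isBlockUnion_of_le hi hΩ
    have hX : IsBlockUnion 1 (innerK i Ω) := isBlockUnion_one_innerK hi' hΩi1
    -- the four inputs at level i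
    have hstar := covPoincare_region (i := j + i) hi' (lineIter U i)
      (fun x μ ν => norm_plaqC_lineIter_sub_one_le U hθ i (by omega) x μ ν) hX (qCovK U i φ)
    have hρ : ∀ (x : Balaban1983to89.Site P j) (μ : Fin P.d),
        ‖(holCK U i x)⁻¹ * toC (lineIter U i ⟨blkIter i x, μ⟩) * holCK U i (runSite x μ (P.L ^ i))
            * (toC (runProd U x μ (P.L ^ i)))⁻¹ - 1‖ ≤ (P.d : ℝ) * ((P.L : ℝ) ^ i) ^ 2 * θ := by
      intro x μ
      have h1 := norm_blockContourDefect_sub_one_le' (k := i) (by omega) U hθ x μ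
      have h2 : (P.d : ℝ) * (P.L : ℝ) ^ i * ((P.L : ℝ) ^ i - 1) * θ ≤ P.d * ((P.L : ℝ) ^ i) ^ 2 * θ := by
        have hn0 : (0 : ℝ) ≤ (P.L : ℝ) ^ i := by positivity
        have : (P.L : ℝ) ^ i * ((P.L : ℝ) ^ i - 1) ≤ ((P.L : ℝ) ^ i) ^ 2 := by nlinarith
        nlinarith [mul_nonneg hd0 hθ0]
      exact h1.trans h2
    have hB := sum_norm_qCovK_shift_sub_sq_region_le_cov (k := i) (by omega) U (lineIter U i) hρ Ω φ
    have hJ := sum_norm_qCovK_sq_region_le (k := i) (by omega) U Ω φ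
    -- exponent bookkeeping
    have eN : (P.L : ℝ) ^ ((i + 1) * P.d) = (P.L : ℝ) ^ (i * P.d) * (P.L : ℝ) ^ P.d := by
      rw [Nat.succ_mul, pow_add]
    have en : (P.L : ℝ) ^ (i + 1) = (P.L : ℝ) ^ i * P.L := pow_succ _ _
    have eθ : (((P.L : ℝ) ^ 2) ^ i * θ) = ((P.L : ℝ) ^ i) ^ 2 * θ := by rw [← pow_mul, ← pow_mul, mul_comm 2 i]
    have eS : ∑ y ∈ innerK (i + 1) Ω, ‖qCovK U (i + 1) φ y‖ ^ 2
        = ∑ y ∈ innerK 1 (innerK i Ω), ‖qCov (lineIter U i) (qCovK U i φ) y‖ ^ 2 := by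
      rw [innerK_succ_eq]; rfl
    rw [eN, en, eS]
    rw [eθ] at hstar
    have hdiv : 2 * (((P.L : ℝ) ^ i) ^ 2 / (P.L : ℝ) ^ (i * P.d)) = 2 * ((P.L : ℝ) ^ i) ^ 2 * ((P.L : ℝ) ^ (i * P.d))⁻¹ := by
      rw [div_eq_mul_inv, mul_assoc]
    have hB' : ∑ b ∈ starB (innerK i Ω), ‖toC (lineIter U i b) * qCovK U i φ b.tgt - qCovK U i φ b.src‖ ^ 2
        ≤ 2 * ((P.L : ℝ) ^ i) ^ 2 * ((P.L : ℝ) ^ (i * P.d))⁻¹ * ∑ b ∈ starB Ω, ‖toC (U b) * φ b.tgt - φ b.src‖ ^ 2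
          + 2 * (P.d : ℝ) ^ 3 * (((P.L : ℝ) ^ i) ^ 2 * θ) ^ 2 * (((P.L : ℝ) ^ (i * P.d))⁻¹ * ∑ x ∈ Ω, ‖φ x‖ ^ 2) := by
      rw [hdiv] at hB
      refine hB.trans (le_of_eq ?_)
      ring
    exact massBound_step_real (a := (P.L : ℝ) ^ P.d) (L := P.L) (Ni := (P.L : ℝ) ^ (i * P.d)) (ni := (P.L : ℝ) ^ i)
      (θ := θ) (d := P.d) hL1 (pow_pos hLpos _) (pow_pos hLpos _) hd0
      (sum_nonneg fun _ _ => by positivity) (sum_nonneg fun _ _ => by positivity) IH hstar hB' hJ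

/-- **The absorbed form on a region**: if `2d³(n²θ)² ≤ 1` then `N^{−1}Σ_{x∈Ω}|φ(x)|² ≤ 2Σ_{y∈Ω^{(k)}}|(Q_k(u)φ)(y)|² + 4(n²/N)Σ_{b⊂Ω}|u_bφ(b₊) − φ(b₋)|²`
(p11's `massBound_small` is `Ω = T`). [cite: BalabanImbrieJaffe1985, (7.3.2) p.326] -/
theorem massBound_region_small {k : ℕ} (hk : j + k ≤ P.m + P.K) (U : GaugeField P j U1) {θ : ℝ}
    (hθ : ∀ (x : Balaban1983to89.Site P j) (μ ν : Fin P.d), ‖plaqC U x μ ν - 1‖ ≤ θ)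
    (hsmall : 2 * (P.d : ℝ) ^ 3 * (((P.L : ℝ) ^ k) ^ 2 * θ) ^ 2 ≤ 1)
    {Ω : Finset (Balaban1983to89.Site P j)} (hΩ : IsBlockUnion k Ω) (φ : HiggsField P j) :
    ((P.L : ℝ) ^ (k * P.d))⁻¹ * ∑ x ∈ Ω, ‖φ x‖ ^ 2
      ≤ 2 * ∑ y ∈ innerK k Ω, ‖qCovK U k φ y‖ ^ 2
        + 4 * ((P.L : ℝ) ^ k) ^ 2 * ((P.L : ℝ) ^ (k * P.d))⁻¹ * ∑ b ∈ starB Ω, ‖toC (U b) * φ b.tgt - φ b.src‖ ^ 2 := by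
  have h := massBound_region hk U hθ hΩ φ
  have hS : 0 ≤ ((P.L : ℝ) ^ (k * P.d))⁻¹ * ∑ x ∈ Ω, ‖φ x‖ ^ 2 := by positivity
  nlinarith [mul_le_mul_of_nonneg_right hsmall hS]

/-! ## §5 **(I.7.3.2) AT A GENERAL SMALL-PLAQUETTE BACKGROUND FOR THE REGION FORM `Δ_k(Ω,u)`** — every `k`-block union `Ω`, every torus -/

/-- kernel: the unit bond form over `Y*` of a field against a unit bond field is `≤ 4d·Σ_{y∈Y}|χ(y)|²` (`|Wχ(b₊) − χ(b₋)|² ≤ 2|χ(b₊)|² + 2|χ(b₋)|²`;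
each site of `Y` is the final resp. initial point of at most `d` bonds of `Y*`). [cite: BalabanImbrieJaffe1985, (7.3.2) p.326] -/
theorem sum_norm_cov_sub_sq_le_four_d {i : ℕ} (Y : Finset (Balaban1983to89.Site P i)) (W : GaugeField P i U1)
    (χ : Balaban1983to89.Site P i → ℂ) :
    ∑ b ∈ starB Y, ‖toC (W b) * χ b.tgt - χ b.src‖ ^ 2 ≤ 4 * P.d * ∑ y ∈ Y, ‖χ y‖ ^ 2 := by
  have h1 : ∑ b ∈ starB Y, ‖toC (W b) * χ b.tgt - χ b.src‖ ^ 2 ≤ ∑ b ∈ starB Y, (2 * ‖χ b.tgt‖ ^ 2 + 2 * ‖χ b.src‖ ^ 2) := by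
    refine sum_le_sum fun b _ => ?_
    have h := norm_add_sq_le_two (toC (W b) * χ b.tgt) (-(χ b.src))
    rw [← sub_eq_add_neg, norm_neg, norm_mul, norm_toC, one_mul] at h
    exact h
  have h2 : ∑ b ∈ starB Y, ‖χ b.tgt‖ ^ 2 ≤ P.d * ∑ y ∈ Y, ‖χ y‖ ^ 2 := sum_starB_tgt_le Y (f := fun y => ‖χ y‖ ^ 2) fun _ => sq_nonneg _
  have h3 : ∑ b ∈ starB Y, ‖χ b.src‖ ^ 2 ≤ P.d * ∑ y ∈ Y, ‖χ y‖ ^ 2 := by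
    rw [sum_starB_eq_sum_ite]
    calc ∑ x : Balaban1983to89.Site P i, ∑ μ : Fin P.d, (if x ∈ Y ∧ x.shift μ ∈ Y then ‖χ (PBond.src ⟨x, μ⟩)‖ ^ 2 else 0)
        ≤ ∑ x : Balaban1983to89.Site P i, ∑ _μ : Fin P.d, (if x ∈ Y then ‖χ x‖ ^ 2 else 0) := by
          refine sum_le_sum fun x _ => sum_le_sum fun μ _ => ?_
          by_cases h1 : x ∈ Y ∧ x.shift μ ∈ Y
          · rw [if_pos h1, if_pos h1.1]
          · rw [if_neg h1]; split_ifs <;> positivity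
      _ = P.d * ∑ y ∈ Y, ‖χ y‖ ^ 2 := by
          simp only [sum_const, card_univ, Fintype.card_fin, nsmul_eq_mul]
          rw [← mul_sum, ← Finset.sum_filter, filter_mem_eq_inter, univ_inter]
  rw [sum_add_distrib, ← mul_sum, ← mul_sum] at h1
  linarith

/-- kernel: `‖(D_uφ)(b)‖² = c²·|u_bφ(b₊) − φ(b₋)|²` for the covariant derivative `(D_uφ)(b) = c(u_bφ(b₊) − φ(b₋))` of (4.6.3).
[cite: BalabanImbrieJaffe1985, (4.6.3) p.313] -/
theorem norm_covD_sq (c : ℝ) (U : GaugeField P j U1) (φ : Balaban1983to89.Site P j → ℂ) (b : PBond P j) :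
    ‖covD c (cfg U) φ b‖ ^ 2 = c ^ 2 * ‖toC (U b) * φ b.tgt - φ b.src‖ ^ 2 := by
  rw [covD, cfg, norm_mul, Complex.norm_real, Real.norm_eq_abs, mul_pow, sq_abs]

/-- kernel (real arithmetic): `p ≤ q + r`, all non-negative ⇒ `p² ≤ 2q² + 2r²`. [folklore] -/
private theorem sq_le_two_sq_add {p q r : ℝ} (hq : 0 ≤ q) (hr : 0 ≤ r) (h : p ≤ q + r) (hp : 0 ≤ p) :
    p ^ 2 ≤ 2 * q ^ 2 + 2 * r ^ 2 := by
  nlinarith [mul_nonneg hp (sub_nonneg.2 h), mul_nonneg hq (sub_nonneg.2 h), mul_nonneg hr (sub_nonneg.2 h),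
    sq_nonneg (q - r)]

/-- kernel (real arithmetic; p11's private `BIJ85Ineq732General.assembly_real`, restated verbatim): THE ASSEMBLY of (7.3.2) at a general background from its five inputs — the value of the form at the
minimizer `aX + Y` (`Y = c²E`), the splitting `E_W(ψ) ≤ 2E_W(ψ − Q_kφ_k) + 2E_W(Q_kφ_k)`, `E_W(ψ − Q_kφ_k) ≤ 4dX`, the covariant
block-averaging inequality with defect (`h2`), the mass bound (`h3`), `‖Q_kφ_k‖² ≤ 2X + 2‖ψ‖²` and `E_W(ψ) ≤ 4d‖ψ‖²`; two regimes
`d³s² ≤ ½` (absorb) and `d³s² > ½` (the claim follows from `Δ_k ≥ 0`). [folklore] -/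
private theorem assembly_real {a c2 X Y E S0 Qn EW EQ B1 Ψ n2 N dd θ : ℝ}
    (ha : 0 < a) (hc2 : 0 < c2) (hN : 0 < N) (hn2 : 0 < n2) (hdd1 : 1 ≤ dd)
    (hX0 : 0 ≤ X) (hE0 : 0 ≤ E) (hS0 : 0 ≤ S0) (hΨ0 : 0 ≤ Ψ)
    (hY : Y = c2 * E) (hsplit : EW ≤ 2 * B1 + 2 * EQ) (hB1 : B1 ≤ 4 * dd * X)
    (h2 : EQ ≤ 2 * (n2 / N) * E + 2 * dd ^ 3 * (n2 * θ) ^ 2 * (N⁻¹ * S0))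
    (h3 : N⁻¹ * S0 ≤ Qn + 2 * n2 * N⁻¹ * E + dd ^ 3 * (n2 * θ) ^ 2 * (N⁻¹ * S0))
    (h4 : Qn ≤ 2 * X + 2 * Ψ) (hEW4 : EW ≤ 4 * dd * Ψ) :
    min (a / (8 * (dd + 1))) (N * c2 / (12 * n2)) * EW - 4 / 3 * dd ^ 4 * (N * c2 / n2) * (n2 * θ) ^ 2 * Ψ
      ≤ a * X + Y := by
  obtain ⟨γ, hγ⟩ : ∃ γ : ℝ, γ = min (a / (8 * (dd + 1))) (N * c2 / (12 * n2)) := ⟨_, rfl⟩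
  obtain ⟨Γ, hΓ⟩ : ∃ Γ : ℝ, Γ = N * c2 / (12 * n2) := ⟨_, rfl⟩
  obtain ⟨t, ht⟩ : ∃ t : ℝ, t = dd ^ 3 * (n2 * θ) ^ 2 := ⟨_, rfl⟩
  obtain ⟨F, hF⟩ : ∃ F : ℝ, F = n2 * N⁻¹ * E := ⟨_, rfl⟩
  obtain ⟨R, hR⟩ : ∃ R : ℝ, R = N⁻¹ * S0 := ⟨_, rfl⟩
  rw [← hγ]
  have hN0 : N ≠ 0 := hN.ne'
  have hn20 : n2 ≠ 0 := hn2.ne'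
  have hdd0 : 0 ≤ dd := by linarith
  have hΓ0 : 0 ≤ Γ := by rw [hΓ]; positivity
  have hγ0 : 0 ≤ γ := by rw [hγ]; exact le_min (by positivity) (by positivity)
  have hγ1 : γ * (8 * (dd + 1)) ≤ a := by
    have h := min_le_left (a / (8 * (dd + 1))) (N * c2 / (12 * n2))
    rw [← hγ, le_div_iff₀ (by positivity)] at h
    exact h
  have hγ2 : γ ≤ Γ := by rw [hγ, hΓ]; exact min_le_right _ _
  have ht0 : 0 ≤ t := by rw [ht]; positivity
  have hF0 : 0 ≤ F := by rw [hF]; positivity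
  have hR0 : 0 ≤ R := by rw [hR]; positivity
  have hY' : Y = 12 * Γ * F := by
    rw [hY, hΓ, hF]
    have e : 12 * (N * c2 / (12 * n2)) * (n2 * N⁻¹ * E) = c2 * E * (N * N⁻¹) * (n2 * n2⁻¹) := by ring
    rw [e, mul_inv_cancel₀ hN0, mul_inv_cancel₀ hn20, mul_one, mul_one]
  have e2a : 2 * (n2 / N) * E = 2 * F := by rw [hF, div_eq_mul_inv]; ring
  have e2b : 2 * dd ^ 3 * (n2 * θ) ^ 2 * (N⁻¹ * S0) = 2 * (t * R) := by rw [ht, hR]; ring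
  have e3a : 2 * n2 * N⁻¹ * E = 2 * F := by rw [hF]; ring
  have e3b : dd ^ 3 * (n2 * θ) ^ 2 * (N⁻¹ * S0) = t * R := by rw [ht, hR]
  have eM : 4 / 3 * dd ^ 4 * (N * c2 / n2) * (n2 * θ) ^ 2 * Ψ = 16 * (Γ * (dd * Ψ) * t) := by rw [hΓ, ht]; ring
  have h2' : EQ ≤ 2 * F + 2 * (t * R) := by linarith
  have h3' : R ≤ Qn + 2 * F + t * R := by linarith
  have pA1 : γ * (8 * (dd + 1)) * X ≤ a * X := mul_le_mul_of_nonneg_right hγ1 hX0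
  have pA2 : γ * F ≤ Γ * F := mul_le_mul_of_nonneg_right hγ2 hF0
  have hpos : 0 ≤ a * X + Y := by rw [hY]; positivity
  rw [eM]
  by_cases hA : t ≤ 1 / 2
  · -- small field strength: absorb the mass term
    have p1 : t * R ≤ 1 / 2 * R := mul_le_mul_of_nonneg_right hA hR0
    have hRb : R ≤ 2 * Qn + 4 * F := by linarith
    have p2 : t * R ≤ t * (2 * Qn + 4 * F) := mul_le_mul_of_nonneg_left hRb ht0
    have p3 : t * Qn ≤ t * (2 * X + 2 * Ψ) := mul_le_mul_of_nonneg_left h4 ht0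
    have p4 : t * X ≤ 1 / 2 * X := mul_le_mul_of_nonneg_right hA hX0
    have p5 : t * F ≤ 1 / 2 * F := mul_le_mul_of_nonneg_right hA hF0
    have hEWb : EW ≤ (8 * dd + 8) * X + 12 * F + 16 * (t * Ψ) := by linarith
    have pEW : γ * EW ≤ γ * ((8 * dd + 8) * X + 12 * F + 16 * (t * Ψ)) := mul_le_mul_of_nonneg_left hEWb hγ0
    have q3 : t ≤ dd * t := by nlinarith [mul_nonneg (sub_nonneg.2 hdd1) ht0]
    have pM : γ * t * Ψ ≤ Γ * (dd * t) * Ψ := mul_le_mul_of_nonneg_right (mul_le_mul hγ2 q3 ht0 hΓ0) hΨ0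
    rw [hY']
    linarith
  · -- large field strength: the claim follows from `Δ_k ≥ 0` and `E_W(ψ) ≤ 4d‖ψ‖²`
    have hA' : 1 / 2 < t := lt_of_not_ge hA
    have q1 : γ * EW ≤ γ * (4 * dd * Ψ) := mul_le_mul_of_nonneg_left hEW4 hγ0
    have r2 : γ * (dd * Ψ) ≤ Γ * (dd * Ψ) := mul_le_mul_of_nonneg_right hγ2 (by positivity)
    have r0 : 0 ≤ Γ * (dd * Ψ) * t := by positivity
    have r1 : Γ * (dd * Ψ) * (1 / 2) ≤ Γ * (dd * Ψ) * t := mul_le_mul_of_nonneg_left hA'.le (by positivity)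
    linarith

/-- **(I.7.3.2) AT A GENERAL `U(1)` BACKGROUND FOR THE REGION FORM `Δ_k(Ω,u)`, EVERY UNION `Ω` OF `k`-BLOCKS, EVERY LEVEL, EVERY TORUS** (p. 326:
*"⟨φ, Δ_k(u_k)φ⟩ ≥ γ Σ_{b∈T₁^{(k)}} |u_k(b)φ(b₊) − φ(b₋)|² − Me_k^{2−α} Σ_{x∈T₁^{(k)}} |φ(x)|². (7.3.2)"*; [7] (1.22) p. 574: *"Let Ω be a sum of unit
blocks … ⟨φ, Δ^{(k)}(Ω,A)φ⟩ ≥ γ₀(Σ_{⟨x,x′⟩⊂Ω^{(k)}} |U(A(⟨x,x′⟩))φ(x′) − φ(x)|² + …) − O(1)e^{2−α}Σ_{x∈Ω^{(k)}}|φ(x)|²"*), for gen 15's torus object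
`Δ_k(Ω,u) = deltaRegion a c u k Ω = a·1 − a²·Q_k(u)G_k(Ω,u)Q_k(u)ᴴ`: for `j + k ≤ m + K`, `a > 0`, `c ≠ 0`, every `U(1)` field `u` on `T^{(j)}` whose
plaquette variables deviate from `1` by at most `θ`, and every unit-lattice field `ψ`, with `n = L^k`, `N = L^{kd}`, `u_k(b) = lineIter u k b` (the
transport of `u` along the unit bond, (5.1.2)):
`min(a/(8(d+1)), Nc²/(12n²))·Σ_{⟨y,y+e_μ⟩⊂Ω^{(k)}}|u_k(b)ψ(b₊) − ψ(b₋)|² − (4/3)d⁴(Nc²/n²)(n²θ)²·Σ_{y∈Ω^{(k)}}|ψ(y)|² ≤ Re ψᴴΔ_k(Ω,u)ψ` — p11's whole-torus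
`BIJ85Ineq732General.ineq732_general` LOCALIZED, same constants; gen 18's `ineq732_flat_region` is the case `θ = 0` (up to constants).  Mechanism:
the energy identity `ψᴴΔ_k(Ω,u)ψ = a‖Q_kφ⋆ − ψ‖² + Σ_{b⊂Ω}‖D_uφ⋆‖²` at `φ⋆ = aG_k(Ω,u)Q_k(u)ᴴψ` (gen 18, every `u`); `E(ψ) ≤ 8d‖ψ − Q_kφ⋆‖²_{Ω^{(k)}} +
2E(Q_kφ⋆)`; §2 for `E(Q_kφ⋆)`; §4 for `N^{−1}Σ_{x∈Ω}|φ⋆|²`; p11's real-variable assembly. [cite: BalabanImbrieJaffe1985, (7.3.2) p.326] -/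
theorem ineq732_smallField_region {k : ℕ} (hk : j + k ≤ P.m + P.K) {c : ℝ} (hc : c ≠ 0) {a : ℝ} (ha : 0 < a) (U : GaugeField P j U1)
    {θ : ℝ} (hθ : ∀ (x : Balaban1983to89.Site P j) (μ ν : Fin P.d), ‖plaqC U x μ ν - 1‖ ≤ θ)
    {Ω : Finset (Balaban1983to89.Site P j)} (hΩ : IsBlockUnion k Ω) (ψ : Balaban1983to89.Site P (j+k) → ℂ) :
    min (a / (8 * (P.d + 1))) ((P.L : ℝ) ^ (k * P.d) * c ^ 2 / (12 * ((P.L : ℝ) ^ k) ^ 2))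
          * ∑ b ∈ starB (innerK k Ω), ‖toC (lineIter U k b) * ψ b.tgt - ψ b.src‖ ^ 2
        - 4 / 3 * (P.d : ℝ) ^ 4 * ((P.L : ℝ) ^ (k * P.d) * c ^ 2 / ((P.L : ℝ) ^ k) ^ 2) * (((P.L : ℝ) ^ k) ^ 2 * θ) ^ 2
          * ∑ y ∈ innerK k Ω, ‖ψ y‖ ^ 2
      ≤ (star ψ ⬝ᵥ (deltaRegion a c U k Ω *ᵥ ψ)).re := by
  have hLpos : (0 : ℝ) < P.L := Nat.cast_pos.2 P.L_pos
  have hNpos : (0 : ℝ) < (P.L : ℝ) ^ (k * P.d) := pow_pos hLpos _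
  have hn2pos : (0 : ℝ) < ((P.L : ℝ) ^ k) ^ 2 := pow_pos (pow_pos hLpos _) _
  have hc2 : 0 < c ^ 2 := by positivity
  have hdd1 : (1 : ℝ) ≤ P.d := by exact_mod_cast P.hd
  have hθ0 : 0 ≤ θ := (norm_nonneg _).trans (hθ default ⟨0, P.hd⟩ ⟨0, P.hd⟩)
  have hd0 : (0 : ℝ) ≤ P.d := Nat.cast_nonneg _
  -- the minimizer φ⋆ = aG_k(Ω,u)Q_k(u)ᴴψ and the energy identity
  set φs : Balaban1983to89.Site P j → ℂ := ((a : ℂ) • (gBox a c U k Ω * (qMatT U k)ᴴ)) *ᵥ ψ with hφs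
  rw [form_deltaRegion_eq_energy hk hc ha U hΩ ψ hφs, Complex.ofReal_re]
  set Qφ : Balaban1983to89.Site P (j+k) → ℂ := qMatT U k *ᵥ φs with hQφ
  have hQφ' : ∀ y, Qφ y = qCovK U k φs y := fun y => by rw [hQφ, qMatT_mulVec]
  -- the real quantities
  obtain ⟨X, hX⟩ : ∃ x : ℝ, x = ∑ y, ‖(Qφ - ψ) y‖ ^ 2 := ⟨_, rfl⟩
  obtain ⟨E, hE⟩ : ∃ x : ℝ, x = ∑ b ∈ starB Ω, ‖toC (U b) * φs b.tgt - φs b.src‖ ^ 2 := ⟨_, rfl⟩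
  obtain ⟨S0, hS0⟩ : ∃ x : ℝ, x = ∑ x ∈ Ω, ‖φs x‖ ^ 2 := ⟨_, rfl⟩
  obtain ⟨Qn, hQn⟩ : ∃ x : ℝ, x = ∑ y ∈ innerK k Ω, ‖qCovK U k φs y‖ ^ 2 := ⟨_, rfl⟩
  obtain ⟨EW, hEW⟩ : ∃ x : ℝ, x = ∑ b ∈ starB (innerK k Ω), ‖toC (lineIter U k b) * ψ b.tgt - ψ b.src‖ ^ 2 := ⟨_, rfl⟩
  obtain ⟨EQ, hEQ⟩ : ∃ x : ℝ, x = ∑ b ∈ starB (innerK k Ω), ‖toC (lineIter U k b) * Qφ b.tgt - Qφ b.src‖ ^ 2 := ⟨_, rfl⟩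
  obtain ⟨B1, hB1⟩ : ∃ x : ℝ, x = ∑ b ∈ starB (innerK k Ω), ‖toC (lineIter U k b) * (ψ - Qφ) b.tgt - (ψ - Qφ) b.src‖ ^ 2 := ⟨_, rfl⟩
  obtain ⟨Ψ, hΨ⟩ : ∃ x : ℝ, x = ∑ y ∈ innerK k Ω, ‖ψ y‖ ^ 2 := ⟨_, rfl⟩
  have hX0 : 0 ≤ X := by rw [hX]; exact sum_nonneg fun _ _ => by positivity
  have hE0 : 0 ≤ E := by rw [hE]; exact sum_nonneg fun _ _ => by positivity
  have hS00 : 0 ≤ S0 := by rw [hS0]; exact sum_nonneg fun _ _ => by positivity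
  have hΨ0 : 0 ≤ Ψ := by rw [hΨ]; exact sum_nonneg fun _ _ => by positivity
  -- Y = c²E
  have hY : ∑ b ∈ starB Ω, ‖covD c (cfg U) φs b‖ ^ 2 = c ^ 2 * E := by
    rw [hE, mul_sum]
    exact sum_congr rfl fun b _ => norm_covD_sq c U φs b
  rw [hY, ← hX, ← hEW, ← hΨ]
  -- (1) E_W(ψ) ≤ 2E_W(ψ − Q_kφ⋆) + 2E_W(Q_kφ⋆), E_W(ψ − Q_kφ⋆) ≤ 4dX
  have hsplit : EW ≤ 2 * B1 + 2 * EQ := by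
    have h := sum_norm_cov_sub_sq_add_le (starB (innerK k Ω)) (fun b => toC (lineIter U k b)) (ψ - Qφ) Qφ
    simp only [sub_add_cancel] at h
    rw [hEW, hB1, hEQ]
    exact h
  have hB1le : B1 ≤ 4 * P.d * X := by
    rw [hB1]
    refine (sum_norm_cov_sub_sq_le_four_d (innerK k Ω) (lineIter U k) (ψ - Qφ)).trans ?_
    refine mul_le_mul_of_nonneg_left ?_ (by positivity)
    rw [hX]
    refine (Finset.sum_le_univ_sum_of_nonneg fun _ => by positivity).trans (le_of_eq (sum_congr rfl fun y _ => ?_))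
    rw [Pi.sub_apply, Pi.sub_apply, norm_sub_rev]
  -- (2) the covariant block-averaging inequality on the region, defect by the plaquettes of `u`
  have hρ : ∀ (x : Balaban1983to89.Site P j) (μ : Fin P.d),
      ‖(holCK U k x)⁻¹ * toC (lineIter U k ⟨blkIter k x, μ⟩) * holCK U k (runSite x μ (P.L ^ k))
          * (toC (runProd U x μ (P.L ^ k)))⁻¹ - 1‖ ≤ (P.d : ℝ) * ((P.L : ℝ) ^ k) ^ 2 * θ := by
    intro x μ
    have h1 := norm_blockContourDefect_sub_one_le' hk U hθ x μ
    have h2 : (P.d : ℝ) * (P.L : ℝ) ^ k * ((P.L : ℝ) ^ k - 1) * θ ≤ P.d * ((P.L : ℝ) ^ k) ^ 2 * θ := by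
      have hn0 : (0 : ℝ) ≤ (P.L : ℝ) ^ k := by positivity
      have : (P.L : ℝ) ^ k * ((P.L : ℝ) ^ k - 1) ≤ ((P.L : ℝ) ^ k) ^ 2 := by nlinarith
      nlinarith [mul_nonneg hd0 hθ0]
    exact h1.trans h2
  have h2 : EQ ≤ 2 * (((P.L : ℝ) ^ k) ^ 2 / (P.L : ℝ) ^ (k * P.d)) * E
      + 2 * (P.d : ℝ) ^ 3 * (((P.L : ℝ) ^ k) ^ 2 * θ) ^ 2 * (((P.L : ℝ) ^ (k * P.d))⁻¹ * S0) := by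
    have h := sum_norm_qCovK_shift_sub_sq_region_le_cov hk U (lineIter U k) hρ Ω φs
    rw [hEQ, hE, hS0]
    simp only [hQφ']
    refine h.trans (le_of_eq ?_)
    ring
  -- (3) the multiscale mass bound on the region
  have h3 : ((P.L : ℝ) ^ (k * P.d))⁻¹ * S0 ≤ Qn + 2 * ((P.L : ℝ) ^ k) ^ 2 * ((P.L : ℝ) ^ (k * P.d))⁻¹ * E
      + (P.d : ℝ) ^ 3 * (((P.L : ℝ) ^ k) ^ 2 * θ) ^ 2 * (((P.L : ℝ) ^ (k * P.d))⁻¹ * S0) := by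
    rw [hS0, hQn, hE]
    exact massBound_region hk U hθ hΩ φs
  -- (4) ‖Q_kφ⋆‖²_{Ω^{(k)}} ≤ 2X + 2‖ψ‖²_{Ω^{(k)}}
  have h4 : Qn ≤ 2 * X + 2 * Ψ := by
    have hX' : ∑ y ∈ innerK k Ω, ‖(Qφ - ψ) y‖ ^ 2 ≤ X := by
      rw [hX]; exact Finset.sum_le_univ_sum_of_nonneg fun _ => by positivity
    rw [hQn, hΨ]
    calc ∑ y ∈ innerK k Ω, ‖qCovK U k φs y‖ ^ 2 ≤ ∑ y ∈ innerK k Ω, (2 * ‖(Qφ - ψ) y‖ ^ 2 + 2 * ‖ψ y‖ ^ 2) := by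
          refine sum_le_sum fun y _ => ?_
          have e : qCovK U k φs y = (Qφ - ψ) y + ψ y := by rw [Pi.sub_apply, hQφ', sub_add_cancel]
          rw [e]
          exact norm_add_sq_le_two _ _
      _ = 2 * ∑ y ∈ innerK k Ω, ‖(Qφ - ψ) y‖ ^ 2 + 2 * ∑ y ∈ innerK k Ω, ‖ψ y‖ ^ 2 := by
          rw [sum_add_distrib, ← mul_sum, ← mul_sum]
      _ ≤ 2 * X + 2 * ∑ y ∈ innerK k Ω, ‖ψ y‖ ^ 2 := by linarith [hX']
  -- (5) E_W(ψ) ≤ 4d‖ψ‖²_{Ω^{(k)}}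
  have hEW4 : EW ≤ 4 * P.d * Ψ := by
    rw [hEW, hΨ]; exact sum_norm_cov_sub_sq_le_four_d (innerK k Ω) (lineIter U k) ψ
  have hdiv : 2 * (((P.L : ℝ) ^ k) ^ 2 / (P.L : ℝ) ^ (k * P.d)) * E = 2 * (((P.L : ℝ) ^ k) ^ 2 / (P.L : ℝ) ^ (k * P.d)) * E := rfl
  exact assembly_real ha hc2 hNpos hn2pos hdd1 hX0 hE0 hS00 hΨ0 rfl hsplit hB1le h2 h3 h4 hEW4

/-- **(I.7.3.2) FOR THE REGION FORM, PRINTED COEFFICIENT AND PHYSICAL NORMALIZATION: constants uniform in `k`, `L`, the volume, `Ω` and `u`** — for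
`1 ≤ k`, `j + k ≤ m + K`, `a > 0`, the coefficient `a_k` of (4.6.2) (`≥ 8a/9`) and `c² = η^{d−2} = n²/N` (p11's `cPhys`), every `U(1)` field `u` with
plaquettes within `θ` of `1`, every `k`-block union `Ω`, every `ψ`, with `s = L^{2k}θ`:
`min(a/(9(d+1)), 1/12)·Σ_{⟨y,y+e_μ⟩⊂Ω^{(k)}}|u_k(b)ψ(b₊) − ψ(b₋)|² − (4/3)d⁴s²·Σ_{y∈Ω^{(k)}}|ψ(y)|² ≤ Re ψᴴΔ_k(Ω,u)ψ` (p11's `ineq732_general_phys`, localized).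
[cite: BalabanImbrieJaffe1985, (7.3.2) p.326] -/
theorem ineq732_smallField_region_phys {k : ℕ} (hk1 : 1 ≤ k) (hk : j + k ≤ P.m + P.K) {a : ℝ} (ha : 0 < a) (U : GaugeField P j U1)
    {θ : ℝ} (hθ : ∀ (x : Balaban1983to89.Site P j) (μ ν : Fin P.d), ‖plaqC U x μ ν - 1‖ ≤ θ)
    {Ω : Finset (Balaban1983to89.Site P j)} (hΩ : IsBlockUnion k Ω) (ψ : Balaban1983to89.Site P (j+k) → ℂ) :
    min (a / (9 * (P.d + 1))) (1 / 12) * ∑ b ∈ starB (innerK k Ω), ‖toC (lineIter U k b) * ψ b.tgt - ψ b.src‖ ^ 2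
        - 4 / 3 * (P.d : ℝ) ^ 4 * (((P.L : ℝ) ^ k) ^ 2 * θ) ^ 2 * ∑ y ∈ innerK k Ω, ‖ψ y‖ ^ 2
      ≤ (star ψ ⬝ᵥ (deltaRegion (BIJ85Sect4Statements.aK a P.L k) (BIJ85Ineq732Flat.cPhys P k) U k Ω *ᵥ ψ)).re := by
  have hL : (1 : ℝ) < P.L := by linarith [three_le_L P]
  have haK := (BIJ85CoefficientAk464.aK_pos_le ha hL hk1).1
  have h := ineq732_smallField_region hk (BIJ85Ineq732Flat.cPhys_pos P k).ne' haK U hθ hΩ ψ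
  have hr := BIJ85Ineq732General.cPhys_ratio P k
  have e12 : (P.L : ℝ) ^ (k * P.d) * BIJ85Ineq732Flat.cPhys P k ^ 2 / (12 * ((P.L : ℝ) ^ k) ^ 2) = 1 / 12 := by
    rw [mul_comm (12 : ℝ), ← div_div, hr]
  rw [e12, hr, mul_one] at h
  refine le_trans ?_ h
  have hE0 : 0 ≤ ∑ b ∈ starB (innerK k Ω), ‖toC (lineIter U k b) * ψ b.tgt - ψ b.src‖ ^ 2 := sum_nonneg fun _ _ => by positivity
  have hγ : min (a / (9 * (P.d + 1))) (1 / 12) ≤ min (BIJ85Sect4Statements.aK a P.L k / (8 * (P.d + 1))) (1 / 12) := by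
    refine min_le_min ?_ le_rfl
    have hd1 : (0 : ℝ) < P.d + 1 := by positivity
    rw [div_le_div_iff₀ (by positivity) (by positivity)]
    have h89 := BIJ85BlockAveragingIneq.aK_ge_eight_ninths P ha.le hk1
    nlinarith [h89, hd1]
  nlinarith [mul_le_mul_of_nonneg_right hγ hE0]

/-! ## §6 The whole torus, the parameter scaling of `Δ_k(Ω,u)` on a region, and gen 15's counting normalization `(A, ε^{−1})` -/

/-- kernel: on the whole torus every unit-lattice site is inner. [cite: BalabanImbrieJaffe1985, (4.6.4) p.313] -/
theorem innerK_univ (k : ℕ) : innerK k (univ : Finset (Balaban1983to89.Site P j)) = (univ : Finset (Balaban1983to89.Site P (j+k))) := by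
  ext y; simp only [mem_innerK, subset_univ, mem_univ]

/-- **(I.7.3.2) AT A GENERAL SMALL-PLAQUETTE BACKGROUND ON THE WHOLE TORUS for gen 15's explicit `Δ_k(T,u) = deltaRegion a c u k T`** — p11's
`ineq732_general` (stated for ANY right inverse `G` in the real-linear-map framework) in the complex-matrix currency of [BalabanImbrieJaffe1988]
(2.34)/(2.35), with the constructed Neumann propagator of record: the region theorem at `Ω = T`. [cite: BalabanImbrieJaffe1985, (7.3.2) p.326] -/
theorem ineq732_smallField_univ {k : ℕ} (hk : j + k ≤ P.m + P.K) {c : ℝ} (hc : c ≠ 0) {a : ℝ} (ha : 0 < a) (U : GaugeField P j U1)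
    {θ : ℝ} (hθ : ∀ (x : Balaban1983to89.Site P j) (μ ν : Fin P.d), ‖plaqC U x μ ν - 1‖ ≤ θ) (ψ : Balaban1983to89.Site P (j+k) → ℂ) :
    min (a / (8 * (P.d + 1))) ((P.L : ℝ) ^ (k * P.d) * c ^ 2 / (12 * ((P.L : ℝ) ^ k) ^ 2))
          * ∑ b : PBond P (j+k), ‖toC (lineIter U k b) * ψ b.tgt - ψ b.src‖ ^ 2
        - 4 / 3 * (P.d : ℝ) ^ 4 * ((P.L : ℝ) ^ (k * P.d) * c ^ 2 / ((P.L : ℝ) ^ k) ^ 2) * (((P.L : ℝ) ^ k) ^ 2 * θ) ^ 2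
          * ∑ y : Balaban1983to89.Site P (j+k), ‖ψ y‖ ^ 2
      ≤ (star ψ ⬝ᵥ (deltaRegion a c U k univ *ᵥ ψ)).re := by
  have h := ineq732_smallField_region hk hc ha U hθ (BIJ88NeumannNoZeroModesTorus.isBlockUnion_univ k) ψ
  rwa [BIJ85Ineq732FlatRegion.starB_innerK_univ, innerK_univ] at h

section Scaling

variable {k : ℕ}

/-- kernel: the Neumann-cut covariant derivative is linear in its normalization constant: `(χ_ΩD_u)_{sc} = s·(χ_ΩD_u)_c`.
[cite: BalabanImbrieJaffe1988, (5.6.10) p.287] -/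
private theorem dN_smul (s c : ℝ) (U : GaugeField P j U1) (Ω : Finset (Balaban1983to89.Site P j)) :
    dN (s * c) U Ω = (s : ℂ) • dN c U Ω := by
  rw [dN, dN, ← Matrix.mul_smul]
  congr 1
  ext b x
  simp only [BIJ88Vj5610Operator.dMat, Matrix.of_apply, Matrix.smul_apply, smul_eq_mul, Complex.ofReal_mul]
  ring

/-- kernel: `H_Ω(u)` is homogeneous of degree two in `(√a, c)`: `nOp (s²a) (sc) = s²·nOp a c` (any `Ω`). [cite: BalabanImbrieJaffe1988, (2.27) p.263] -/
private theorem nOp_smul (s a c : ℝ) (U : GaugeField P j U1) (k : ℕ) (Ω : Finset (Balaban1983to89.Site P j)) :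
    nOp (s ^ 2 * a) (s * c) U k Ω = ((s : ℂ) ^ 2) • nOp a c U k Ω := by
  rw [nOp_eq, nOp_eq, dN_smul, conjTranspose_smul, Matrix.smul_mul, Matrix.mul_smul, smul_smul, smul_add, smul_smul,
    Complex.star_def, Complex.conj_ofReal, Complex.ofReal_mul, Complex.ofReal_pow, sq]

/-- **THE REGION PROPAGATOR SCALES INVERSELY**: `G_k(Ω,u)_{(s²a, sc)} = s^{−2}·G_k(Ω,u)_{(a,c)}` on every `k`-block union `Ω` (`s ≠ 0`; both are THE
left inverse of `H_Ω(u)` supported on `Ω`, gen 15's `eq_gBox_of_left_inverse`); gen 19's `gBox_univ_smul` is `Ω = T`. [cite: BalabanImbrieJaffe1988, (2.27) p.263] -/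
theorem gBox_smul (hk : j + k ≤ P.m + P.K) {s a c : ℝ} (hs : s ≠ 0) (hc : c ≠ 0) (ha : 0 < a) (U : GaugeField P j U1)
    {Ω : Finset (Balaban1983to89.Site P j)} (hΩ : IsBlockUnion k Ω) :
    gBox (s ^ 2 * a) (s * c) U k Ω = ((s : ℂ) ^ 2)⁻¹ • gBox a c U k Ω := by
  have hs2a : 0 < s ^ 2 * a := by positivity
  have hN := isUnit_nPad hk hc ha U hΩ
  have hN' := isUnit_nPad hk (mul_ne_zero hs hc) hs2a U hΩ
  have hs2 : ((s : ℂ) ^ 2) ≠ 0 := pow_ne_zero _ (Complex.ofReal_ne_zero.2 hs)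
  symm
  refine eq_gBox_of_left_inverse hN' ?_ ?_
  · rw [nOp_smul, Matrix.smul_mul, Matrix.mul_smul, smul_smul, inv_mul_cancel₀ hs2, one_smul, gBox_mul_nOp hN]
  · rw [Matrix.smul_mul, gBox_mul_proj]

/-- **`Δ_k(Ω,u)` is homogeneous of degree two in `(√a, c)`** on every `k`-block union: `Δ_k(Ω,u)_{(s²a, sc)} = s²·Δ_k(Ω,u)_{(a,c)}` — whence gen 15's
counting normalization `(A, ε^{−1}) = (s²a_k, s·c_phys)`, `s² = L^{kd}/(L^kε)²`, is `(A/a_k)×` the printed `Δ_k(Ω,u)`; gen 19's `deltaRegion_univ_smul`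
is `Ω = T`. [cite: BalabanImbrieJaffe1988, (2.34) p.263] -/
theorem deltaRegion_smul (hk : j + k ≤ P.m + P.K) {s a c : ℝ} (hs : s ≠ 0) (hc : c ≠ 0) (ha : 0 < a) (U : GaugeField P j U1)
    {Ω : Finset (Balaban1983to89.Site P j)} (hΩ : IsBlockUnion k Ω) :
    deltaRegion (s ^ 2 * a) (s * c) U k Ω = ((s : ℂ) ^ 2) • deltaRegion a c U k Ω := by
  have hs2 : ((s : ℂ) ^ 2) ≠ 0 := pow_ne_zero _ (Complex.ofReal_ne_zero.2 hs)
  rw [deltaRegion, deltaRegion, gBox_smul hk hs hc ha U hΩ, Matrix.mul_smul, Matrix.smul_mul, smul_smul, smul_sub, smul_smul,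
    smul_smul, Complex.ofReal_mul, Complex.ofReal_pow]
  congr 2
  field_simp

/-- kernel: the Hermitian form scales accordingly on a region: `Re ψᴴΔ_{(s²a,sc)}ψ = s²·Re ψᴴΔ_{(a,c)}ψ`. [cite: BalabanImbrieJaffe1988, (2.34) p.263] -/
theorem re_form_deltaRegion_smul (hk : j + k ≤ P.m + P.K) {s a c : ℝ} (hs : s ≠ 0) (hc : c ≠ 0) (ha : 0 < a) (U : GaugeField P j U1)
    {Ω : Finset (Balaban1983to89.Site P j)} (hΩ : IsBlockUnion k Ω) (ψ : Balaban1983to89.Site P (j + k) → ℂ) :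
    (star ψ ⬝ᵥ (deltaRegion (s ^ 2 * a) (s * c) U k Ω *ᵥ ψ)).re = s ^ 2 * (star ψ ⬝ᵥ (deltaRegion a c U k Ω *ᵥ ψ)).re := by
  rw [deltaRegion_smul hk hs hc ha U hΩ, smul_mulVec, dotProduct_smul, smul_eq_mul, ← Complex.ofReal_pow, Complex.re_ofReal_mul]

end Scaling

/-- **(I.7.3.2) FOR GEN 15's OBJECT OF RECORD `Δ_k(Ω,u) = deltaRegion (α_kL^{kd}) ε^{−1} u k Ω` ON EVERY `k`-BLOCK UNION** (counting normalization
`(A, ε^{−1})`, `A = α_k(a)L^{kd}`, on the `ε`-lattice `T^{(0)}`): at every `U(1)` background `u` with plaquettes within `θ` of `1`, for EVERY `ψ` on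
`T^{(k)}`, `(A/a_k)·[γ₀·Σ_{⟨y,y+e_μ⟩⊂Ω^{(k)}}|u_k(b)ψ(b₊) − ψ(b₋)|² − (4/3)d⁴(L^{2k}θ)²·Σ_{y∈Ω^{(k)}}|ψ(y)|²] ≤ Re ψᴴΔ_k(Ω,u)ψ`, `γ₀ = min(a/(9(d+1)), 1/12)` — the
REGION analogue at a general small-plaquette `u` of gen 19's `BIJ88Decay241SmallFieldTorus.ineq238_deltaRegion_bg454` (there: `Ω = T`, (4.5.4)
backgrounds), i.e. the [I]-side input of the non-flat (2.38) for `Δ_{k,loc}(u)` *"in view of (2.35)"* on the `k`-block cubes `□^{(k)}_α`; by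
`ineq732_smallField_region_phys` and the degree-two homogeneity `deltaRegion_smul` (`(A, ε^{−1}) = (s²a_k, s·c_phys)`, `s² = A/a_k`).
[cite: BalabanImbrieJaffe1988, (2.38) p.264] -/
theorem ineq238_deltaRegion_smallField_region {k : ℕ} (hk1 : 1 ≤ k) (hk : 0 + k ≤ P.m + P.K) {a : ℝ} (ha : 0 < a)
    (U : GaugeField P 0 U1) {θ : ℝ} (hθ : ∀ (x : Balaban1983to89.Site P 0) (μ ν : Fin P.d), ‖plaqC U x μ ν - 1‖ ≤ θ)
    {Ω : Finset (Balaban1983to89.Site P 0)} (hΩ : IsBlockUnion k Ω) (ψ : Balaban1983to89.Site P (0 + k) → ℂ) :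
    (B1RG242Torus.α P a k * (P.L : ℝ) ^ (k * P.d)) / B1.aSeq a P.L k *
        (min (a / (9 * (P.d + 1))) (1 / 12) * ∑ b ∈ starB (innerK k Ω), ‖toC (lineIter U k b) * ψ b.tgt - ψ b.src‖ ^ 2
          - 4 / 3 * (P.d : ℝ) ^ 4 * (((P.L : ℝ) ^ k) ^ 2 * θ) ^ 2 * ∑ y ∈ innerK k Ω, ‖ψ y‖ ^ 2)
      ≤ (star ψ ⬝ᵥ (deltaRegion (B1RG242Torus.α P a k * (P.L : ℝ) ^ (k * P.d)) P.eps⁻¹ U k Ω *ᵥ ψ)).re := by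
  have hL : (1 : ℝ) < P.L := by linarith [three_le_L P]
  have haK := (BIJ85CoefficientAk464.aK_pos_le ha hL hk1).1
  have hcP := BIJ85Ineq732Flat.cPhys_pos P k
  have hε := P.eps_pos
  obtain ⟨s, hs⟩ : ∃ s : ℝ, s = P.eps⁻¹ / BIJ85Ineq732Flat.cPhys P k := ⟨_, rfl⟩
  have hs0 : 0 < s := by rw [hs]; positivity
  have e1 : s * BIJ85Ineq732Flat.cPhys P k = P.eps⁻¹ := by rw [hs, div_mul_cancel₀ _ hcP.ne']
  have e2 : s ^ 2 * BIJ85Sect4Statements.aK a P.L k = B1RG242Torus.α P a k * (P.L : ℝ) ^ (k * P.d) := by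
    have hL' : (0 : ℝ) < (P.L : ℝ) ^ k := pow_pos P.cast_L_pos _
    have hLd : (0 : ℝ) < (P.L : ℝ) ^ (k * P.d) := pow_pos P.cast_L_pos _
    rw [hs, BIJ85CoefficientAk464.aK_eq_aSeq, B1RG242Torus.α, div_pow, inv_pow, BIJ85Ineq732Flat.cPhys_sq]
    unfold Params.spacing
    field_simp
  have e3 : B1RG242Torus.α P a k * (P.L : ℝ) ^ (k * P.d) / B1.aSeq a P.L k = s ^ 2 := by
    rw [← e2, BIJ85CoefficientAk464.aK_eq_aSeq, mul_div_assoc, div_self (B1.aSeq_pos ha (B1RG242Torus.one_lt_cast_L P) hk1).ne', mul_one]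
  rw [e3, ← e2, ← e1, re_form_deltaRegion_smul hk hs0.ne' hcP.ne' haK U hΩ]
  exact mul_le_mul_of_nonneg_left (ineq732_smallField_region_phys hk1 hk ha U hθ hΩ ψ) (sq_nonneg s)

end

end Literature.MathematicalPhysics.QuantumFieldTheory.BalabanImbrieJaffe1984to88.BIJ85Ineq732SmallFieldRegion
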